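import Literature.MathematicalPhysics.QuantumFieldTheory.Balaban1983to89.T4AgeZeroLayer

/-!
# T⁴ programme, node U5b/U5.E — THE MULTI-AGE PATTERN LAYER of the η-design at ANY `K`-free window depth: a flip-closed
# PATTERNED block (sibling suppression `2`, free) next to a FIXED-polarity block (its suppression a binder), the layer's term
# representation, neutrality and the end-to-end plug into `T4FinestToWindow.cauchy_of_finest` (owed item (o1)-LEAN, second
# cut — generic skeleton —, of record `t4/T4-EST-U5bE2.md` §22.6 + §23.4; cell `pub-balaban`, estimate row T4-U5b.E2, lineage
# pv07, journal self-row T4-U5b.E2-ETA-O1-LEAN2°; version tag v1 (2026-08-19); LOW LEAF: imports `T4AgeZeroLayer` v1 only;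
# ADDITIVE — no existing module is modified)

HONEST FRAMING.  This module is KERNEL BOOKKEEPING (finite sums, a reindexing by an involution, Bochner-integral linearity)
for the cell's η-design.  It proves NO estimate of [Balaban1988RG2] / [Balaban1989LargeFieldI] / [Balaban1989LargeFieldII],
quotes NO sentence of Bałaban's series, carries NO cite tag and asserts nothing printed: every declaration is a statement about
the tree's own typed objects (`T4LipschitzLedger.TermRepr`/`sibW`/`Pol`/`facAt`/`sibAt`, `T4LipschitzCutoff.SiblingSuppression`/
`sibling`/`lipWeight`, `T4WeightBudget.RelWeightBound`, `T4FinestToWindow.oldTr`/`oldDensity`/`cauchy_of_finest`,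
`T4AgeZeroLayer.patPol`/`polFlip`/`layerThr`/`layerRem`, `Setup.fieldMeasure`, `T4Continuum.T4Family`) and is tagged [folklore].
NOT summit progress; rung (B)+1 bookkeeping on one four-torus; NOT infinite volume, NOT a mass gap, NOT the Clay problem.

## What the layer is (cell bookkeeping; the SHAPE of a decomposition of unity over declared slots, not a printed statement)

`T4AgeZeroLayer` treated the LAST decomposition of unity of a run (window depth `N_W = 0`, one cube factor per age-`0` slot).
This module is its generalisation to the shape the η-design actually files (record §21–§23): an OLDER-HISTORY label `τ' ∈ T₀ K`
carries a `K`-FREE window depth `NW₀ τ'` (`T4FinestToWindow`: the window is where the declared slot variables are read, through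
the old transport `oldTr F EML K_X (NW₀ τ')`) and `m₀ K τ'` DECLARED profile slot factors with pattern-free slots `slot₀ K τ' i`,
thresholds `θ₀ K τ' i` and window functionals `v K τ' i` (functions of the WINDOW field `GaugeField (F.P (NW₀ τ')) 0 (SU N)`);
the first `md K τ' ≤ m₀ K τ'` of them form the PATTERNED block — every one of the `2^{md}` polarity patterns `S ⊆ range md` is a
term `(τ', S)` of the layered family `layerT₂ T₀ md K`, polarity LARGE on `S` and SMALL off `S` (`T4AgeZeroLayer.patPol`) — and the
remaining `m₀ − md` form the FIXED block, polarity `fpol K τ' i` the same for every pattern (the cell's sibling-less species, record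
§23: their sibling bound is NOT a reindexing identity but a small-field-floor estimate, and enters here ONLY as a binder).  The
finest-level remainder `R_X K t τ'` of the older history is PATTERN-FREE (`T4AgeZeroLayer.layerRem`).  Kernel consequences, with no
hypothesis beyond measurability / integrability / nonnegativity of the data and `md ≤ m₀`, injectivity of `slot₀` on the patterned
block:

* §2–§3 (GENERIC, any represented run on a sample-space family depending on the term only through its older history `τ.1`):
  the slot-`σ` sibling weight `sibW` SPLITS as the patterned part `sibWd` plus the fixed part `sibWf` (`sibW_eq_sibWd_add_sibWf`);
  a PARTIALLY flip-closed bookkeeping (`FlipClosed₂`: the flip `τ ↦ (τ.1, ψ K σ τ)` toggles the polarity of the patterned factor in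
  slot `σ`, keeps every other factor and the remainder) gives `Σ_τ sibWd_σ(τ) ≤ 2 · Σ_τ X(τ)` (`siblingSuppression_two_of_flip₂`;
  per term `sibWd ≤ X(τ) + X(flip τ)` by `T4AgeZeroLayer.sibling_eq_prod_add_prod`, then `Finset.sum_nbij'`), hence
  `SiblingSuppression … sibW … (fun a ↦ 2 + S_f a)` from ANY bound `S_f` on the fixed part (`siblingSuppression_of_flip₂_add`, the
  sum form of `T4SiblingInsertion.siblingSuppression_add`);
* §4 the layer: `termRepr_layer₂(_A/_B)` INHABIT the binders `hA`/`hB` of `cauchy_of_finest` with `NW := fun τ ↦ NW₀ τ.1` (term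
  weights DEFINED as the representing integrals `layerX₂`); NEUTRALITY `sum_patterns_layerX₂` (the `2^{md}` patterns over `τ'` total
  the FIXED-BLOCK WEIGHT `fixW … τ' = ∫ (∏_{fixed} fac) · R_X K t τ' dU`, §1 `sum_powerset_prod_mixed`), so partition functions,
  positivity and the bad-class bound `RelWeightBound` transfer from the older family (`relWeightBound_layer₂`); the layered family is
  `FlipClosed₂` (`flipClosed_layer₂`, flip = toggle the pattern at the patterned position sitting in slot `σ`, `layerPsi`) and its
  window representation has pattern-free remainder `oldDensity F EML K_X (NW₀ τ') (R_X K t τ')`, whence `siblingSuppression_layer₂`;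
* §5 the FIXED block ALONE, reindexed from `0` (`fixM`/`fixSlot`/`fixPol`/`fixThr`/`fixVar`), is a represented family of the OLDER
  histories (`termRepr_fixed`, on the window `termRepr_fixed_window`; weights `fixW`, window sibling weights `fixSibW`), and the
  patterns SUM OUT of the layered family's fixed-part sibling weights (`sum_patterns_layerSibWf`, §1 `sum_powerset_sibAt_mixed` under
  the integral sign), so a sibling suppression `S_f` of the fixed block stated at the OLDER level — `SiblingSuppression l₀ T₀ fixW …
  fixSibW S_f`, the socket shape of `T4SiblingInsertion` — IS the layered family's fixed-part suppression
  (`siblingSuppression_layerSibWf_of_fixed`): the pattern layer is invisible to the fixed block's bound;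
* §6 `cauchy_of_finest_layer₂`: `cauchy_of_finest` with `hA`, `hB`, `hT`, `hmeas`, `hF`, `hSA`/`hSB` (patterned part, and the
  transport of the fixed part through the layer), `hS`, `hZA`, `hZB`, `hpos`, `hW` DISCHARGED onto older-history-level data; what
  REMAINS as binders is exactly, ALL AT THE OLDER (pattern-free) LEVEL: the two-run closeness `hvc` of the window functionals (node
  U1a's rate `ρ`), the FIXED block's sibling suppression `S_f` in both runs (`hfixA`/`hfixB` on `fixW`/`fixSibW`: the small-field
  floor's socket, cf. `T4SiblingInsertion.shellWeightBound_of_towerBound_add_levels` — NOT proved here), node U5b's two-sided factor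
  ledger `hsw` between the old densities on the good older histories, the older family's `RelWeightBound` (cell estimate NE7b), and
  the numerical condition `W K + Σ_{a ≤ N₀} n a · lipWeight Lχ (2 + S_f) ρ a K < 1`; `cauchy_of_finest_patterned` is the
  all-patterned case (`md = m₀`: empty fixed block, `S_f = 0` discharged by `siblingSuppression_sibW_of_eq_zero`).

What this second cut does NOT decide (record §21–§23, owed to the referee's rulings, all left as the binders above or as the
caller's choice of data): WHICH letters of a term are patterned and which fixed (Q-o1-6), the gauge-invariant typing of the
block-axial species (Q-o1-5), the band cap `N₀` versus the printed `N(g_k)` (Q-o1-2), the small-field floor producing `S_f`, and the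
rates `ρ`, `δ`, `W`.  The age-`0` layer of `T4AgeZeroLayer` is the instance `NW₀ ≡ 0`, `md = m₀ = nc`, `slot₀ K τ' i = ⟨0, i⟩`.
-/

open MeasureTheory Finset
open scoped NNReal ENNReal symmDiff

namespace Literature.MathematicalPhysics.QuantumFieldTheory.Balaban1983to89.T4PatternLayer

open T4Continuum T4LevelShift T4AveragingDisintegration T4WindowLevelShift T4LipschitzLedger T4FiniteEpsInhabited
  BlockAveraging ExpMeanLog T4FinestToWindow T4AgeZeroLayer
open T4IndicatorShell T4LipschitzCutoff T4WeightBudget T4HybridMatching T4CauchySum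

/-! ## §1 Pattern algebra: flipping a set of positions; the mixed decomposition of unity -/

section Patterns

/-- flipping AT a set `P` of positions: a position in `P` has its polarity flipped … [folklore] -/
theorem patPol_symmDiff_of_mem {S P : Finset ℕ} {j : ℕ} (h : j ∈ P) : patPol (S ∆ P) j = polFlip (patPol S j) := by
  by_cases hj : j ∈ S
  · rw [patPol_of_mem hj, polFlip_large, patPol_of_not_mem]
    simp [Finset.mem_symmDiff, hj, h]
  · rw [patPol_of_not_mem hj, polFlip_small, patPol_of_mem]
    simp [Finset.mem_symmDiff, hj, h]

/-- … a position off `P` keeps it. [folklore] -/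
theorem patPol_symmDiff_of_not_mem {S P : Finset ℕ} {j : ℕ} (h : j ∉ P) : patPol (S ∆ P) j = patPol S j := by
  by_cases hj : j ∈ S
  · rw [patPol_of_mem hj, patPol_of_mem]
    simp [Finset.mem_symmDiff, hj, h]
  · rw [patPol_of_not_mem hj, patPol_of_not_mem]
    simp [Finset.mem_symmDiff, hj, h]

/-- flipping inside a range stays inside the range. [folklore] -/
theorem symmDiff_subset_of_subset₂ {S P R : Finset ℕ} (hS : S ⊆ R) (hP : P ⊆ R) : S ∆ P ⊆ R :=
  (symmDiff_le_sup (a := S) (b := P)).trans (sup_le hS hP)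

/-- **THE MIXED DECOMPOSITION OF UNITY**: with the first `md ≤ m` positions patterned and the rest of fixed polarity,
`Σ_{S ⊆ range md} ∏_{i<m} fac_i = ∏_{md ≤ i < m} fac_i` — the patterned block sums to one (`T4AgeZeroLayer.sum_powerset_prod_patFac`)
in front of the fixed block. [folklore] -/
theorem sum_powerset_prod_mixed {md m : ℕ} (hmd : md ≤ m) (fpol : ℕ → Pol) (x : ℕ → ℝ) :
    ∑ S ∈ (range md).powerset, ∏ i ∈ range m, (if i < md then patPol S i else fpol i).fac (x i) =
      ∏ i ∈ Ico md m, (fpol i).fac (x i) := by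
  have hsplit : ∀ S : Finset ℕ, ∏ i ∈ range m, (if i < md then patPol S i else fpol i).fac (x i) =
      (∏ i ∈ range md, (patPol S i).fac (x i)) * ∏ i ∈ Ico md m, (fpol i).fac (x i) := by
    intro S
    rw [← prod_range_mul_prod_Ico _ hmd]
    congr 1
    · exact prod_congr rfl fun i hi => by rw [if_pos (mem_range.1 hi)]
    · exact prod_congr rfl fun i hi => by rw [if_neg (not_lt.2 (mem_Ico.1 hi).1)]
  rw [sum_congr rfl fun S _ => hsplit S, ← sum_mul, sum_powerset_prod_patFac, one_mul]

/-- **THE PATTERNED BLOCK IS INVISIBLE TO A FIXED FACTOR'S SIBLING PRODUCT**: summed over the `2^{md}` patterns, the shell-restricted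
sibling product (`T4LipschitzLedger.sibAt`) of the FIXED position `md + k` of the mixed family is the shell-restricted sibling product
of position `k` of the fixed block ALONE (reindexed by `md + ·`): the patterned factors in front of it total `1`
(`T4AgeZeroLayer.sum_powerset_prod_patFac`), the fixed ones are pattern-free. [folklore] -/
theorem sum_powerset_sibAt_mixed {md m : ℕ} (χ : ℕ → ℝ → ℝ) (κ : ℕ → ℝ) (sl : ℕ → Σ _ : ℕ, ℕ) (fpol : ℕ → Pol)
    (θ : ℕ → ℝ) (u : ℕ → ℝ) (w : ℝ) (k : ℕ) :
    ∑ S ∈ (range md).powerset, sibAt χ κ sl (fun i => if i < md then patPol S i else fpol i) θ u w m (md + k) =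
      sibAt χ κ (fun k' => sl (md + k')) (fun k' => fpol (md + k')) (fun k' => θ (md + k')) (fun k' => u (md + k')) w
        (m - md) k := by
  have hk : ¬ md + k < md := Nat.not_lt.2 (Nat.le_add_right md k)
  have hS : ∀ S : Finset ℕ, sibAt χ κ sl (fun i => if i < md then patPol S i else fpol i) θ u w m (md + k) =
      (fpol (md + k)).shell (u (md + k)) (θ (md + k)) (κ (sl (md + k)).1) (w * θ (md + k)) *
        ((∏ i ∈ range md, (patPol S i).fac (χ (sl i).1 (u i / θ i))) *
          ((∏ i ∈ Ico md (md + k), (fpol i).fac (χ (sl i).1 (u i / θ i))) *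
            ∏ i ∈ Ico (md + k + 1) m, (fpol i).fac (χ (sl i).1 (u i / θ i)))) := by
    intro S
    unfold sibAt sibling facAt
    dsimp only
    rw [if_neg hk, ← prod_range_mul_prod_Ico _ (Nat.le_add_right md k), mul_assoc]
    congr 2
    · exact prod_congr rfl fun i hi => by rw [if_pos (mem_range.1 hi)]
    · congr 1
      · exact prod_congr rfl fun i hi => by rw [if_neg (not_lt.2 (mem_Ico.1 hi).1)]
      · exact prod_congr rfl fun i hi => by
          rw [if_neg (not_lt.2 ((Nat.le_add_right md k).trans (Nat.le_of_succ_le (mem_Ico.1 hi).1)))]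
  rw [sum_congr rfl fun S _ => hS S, ← mul_sum, ← sum_mul, sum_powerset_prod_patFac, one_mul]
  unfold sibAt sibling facAt
  dsimp only
  congr 1
  rw [prod_Ico_eq_prod_range, prod_Ico_eq_prod_range, prod_Ico_eq_prod_range, Nat.add_sub_cancel_left, Nat.sub_sub]
  congr 1
  refine prod_congr rfl fun x _ => ?_
  rw [show md + k + 1 + x = md + (k + 1 + x) by omega]

end Patterns

/-! ## §2 The sibling weight of a slot splits: patterned positions `< md`, fixed positions `md ≤ · < m` -/

section Parts

variable {ι : Type*} {Ω : ℕ → ι → Type*} [∀ K τ, MeasurableSpace (Ω K τ)]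

/-- THE PATTERNED PART of the realized shell-restricted sibling weight of slot `σ` (`T4LipschitzLedger.sibW` with the factor sum
restricted to the positions `< md K τ`). [folklore] -/
noncomputable def sibWd (χ : ℕ → ℝ → ℝ) (κ : ℕ → ℝ) (μ : (K : ℕ) → (τ : ι) → Measure (Ω K τ)) (md m : ℕ → ι → ℕ)
    (slot : ℕ → ι → ℕ → Σ _ : ℕ, ℕ) (pol : ℕ → ι → ℕ → Pol) (θ : ℕ → ι → ℕ → ℝ)
    (uX : (K : ℕ) → (τ : ι) → ℕ → Ω K τ → ℝ) (RX : (K : ℕ) → ℝ → (τ : ι) → Ω K τ → ℝ) (ρ : ℕ → ℝ)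
    (σ : Σ _ : ℕ, ℕ) (K : ℕ) (t : ℝ) (τ : ι) : ℝ :=
  ∑ i ∈ range (md K τ) with slot K τ i = σ,
    ∫ v, sibAt χ κ (slot K τ) (pol K τ) (θ K τ) (fun j => uX K τ j v) (ρ (K - (slot K τ i).1)) (m K τ) i * RX K t τ v
      ∂(μ K τ)

/-- THE FIXED PART of the realized shell-restricted sibling weight of slot `σ` (positions `md K τ ≤ i < m K τ`). [folklore] -/
noncomputable def sibWf (χ : ℕ → ℝ → ℝ) (κ : ℕ → ℝ) (μ : (K : ℕ) → (τ : ι) → Measure (Ω K τ)) (md m : ℕ → ι → ℕ)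
    (slot : ℕ → ι → ℕ → Σ _ : ℕ, ℕ) (pol : ℕ → ι → ℕ → Pol) (θ : ℕ → ι → ℕ → ℝ)
    (uX : (K : ℕ) → (τ : ι) → ℕ → Ω K τ → ℝ) (RX : (K : ℕ) → ℝ → (τ : ι) → Ω K τ → ℝ) (ρ : ℕ → ℝ)
    (σ : Σ _ : ℕ, ℕ) (K : ℕ) (t : ℝ) (τ : ι) : ℝ :=
  ∑ i ∈ Ico (md K τ) (m K τ) with slot K τ i = σ,
    ∫ v, sibAt χ κ (slot K τ) (pol K τ) (θ K τ) (fun j => uX K τ j v) (ρ (K - (slot K τ i).1)) (m K τ) i * RX K t τ v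
      ∂(μ K τ)

variable {χ : ℕ → ℝ → ℝ} {κ Lχ : ℕ → ℝ} {μ : (K : ℕ) → (τ : ι) → Measure (Ω K τ)} {md m : ℕ → ι → ℕ}
  {slot : ℕ → ι → ℕ → Σ _ : ℕ, ℕ} {pol : ℕ → ι → ℕ → Pol} {θ : ℕ → ι → ℕ → ℝ} {uX uY : (K : ℕ) → (τ : ι) → ℕ → Ω K τ → ℝ}
  {RX : (K : ℕ) → ℝ → (τ : ι) → Ω K τ → ℝ} {ρ : ℕ → ℝ} {σ : Σ _ : ℕ, ℕ} {K : ℕ} {t : ℝ} {τ : ι}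
  {l₀ : ℝ} {T : ℕ → Finset ι} {X : ℕ → ℝ → ι → ℝ} {N : ℕ} {n : ℕ → ℕ}

/-- **THE SPLIT**: `sibW_σ = sibWd_σ + sibWf_σ` when `md ≤ m` (the factor positions `range m = range md ∪ Ico md m`, disjointly).
[folklore] -/
theorem sibW_eq_sibWd_add_sibWf (h : md K τ ≤ m K τ) :
    sibW χ κ μ m slot pol θ uX RX ρ σ K t τ =
      sibWd χ κ μ md m slot pol θ uX RX ρ σ K t τ + sibWf χ κ μ md m slot pol θ uX RX ρ σ K t τ := by
  have hr : range (m K τ) = range (md K τ) ∪ Ico (md K τ) (m K τ) := by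
    rw [range_eq_Ico, range_eq_Ico, Ico_union_Ico_eq_Ico (Nat.zero_le _) h]
  have hd : Disjoint (range (md K τ)) (Ico (md K τ) (m K τ)) := by
    rw [range_eq_Ico]
    exact Ico_disjoint_Ico_consecutive 0 (md K τ) (m K τ)
  unfold sibW sibWd sibWf
  rw [hr, filter_union, sum_union (disjoint_filter_filter hd)]

/-- the fixed part is nonnegative on the terms of a represented run. [folklore] -/
theorem sibWf_nonneg (h : TermRepr l₀ T X χ κ Lχ N n μ m slot pol θ uX uY RX) (ht : |t| ≤ l₀) (hτ : τ ∈ T K) :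
    0 ≤ sibWf χ κ μ md m slot pol θ uX RX ρ σ K t τ := by
  unfold sibWf
  refine sum_nonneg fun i hi => integral_nonneg_of_ae ?_
  have hi' : i < m K τ := (mem_Ico.1 (mem_filter.1 hi).1).2
  filter_upwards [h.rem_nonneg K t ht τ hτ] with v hv
  exact mul_nonneg (sibAt_nonneg h.profile hi') hv

/-- **NO FACTORS ⇒ NO SIBLING WEIGHT**: a family with `m = 0` factors on its terms has `SiblingSuppression … sibW … (fun _ ↦ 0)` (used for
an EMPTY fixed block, §6). [folklore] -/
theorem siblingSuppression_sibW_of_eq_zero (h : ∀ K, ∀ τ ∈ T K, m K τ = 0) :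
    SiblingSuppression l₀ T X N n (sibW χ κ μ m slot pol θ uX RX ρ) (fun _ => 0) := by
  intro σ _ K t _
  have h0 : ∀ τ ∈ T K, sibW χ κ μ m slot pol θ uX RX ρ σ K t τ = 0 := fun τ hτ => by
    unfold sibW
    rw [h K τ hτ, range_zero, filter_empty, sum_empty]
  rw [sum_congr rfl h0, sum_const_zero]
  show (0 : ℝ) ≤ 0 * _
  rw [zero_mul]

end Parts

/-! ## §3 Generic: a PARTIALLY flip-closed term family (flips of the patterned block, remainders flip-invariant) has sibling
suppression `2` on the patterned part — for sample spaces depending on the term through its older history only -/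

section Flip

variable {ι₀ π : Type*} {Ω' : ℕ → ι₀ → Type*} [∀ K τ', MeasurableSpace (Ω' K τ')]

/-- **PARTIAL FLIP-CLOSURE DATA** of a run's term bookkeeping on the index type `ι₀ × π` (older history × pattern label; cell
bookkeeping, NOT a printed statement): for every cutoff `K` and slot `σ`, a relabelling `ψ K σ` of the pattern component — the
flip `τ ↦ (τ.1, ψ K σ τ)` NEVER touches the older history, so that term-dependent sample spaces `Ω' K τ.1`, measures and remainders
are literally the same for a term and its flip — which, on the run's terms `T K`, (i) stays in `T K`, (ii) is an involution, (iii)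
preserves the numbers `md ≤ m` of patterned / all factors, their slots, thresholds and tested variables, (iv) preserves the polarity
of every factor other than a PATTERNED factor in slot `σ` and FLIPS the polarity of the patterned factor in slot `σ`; and (v) no two
patterned factors of a term share a slot.  (Fixed factors may share slots with anything: they are never flipped.) [folklore] -/
structure FlipClosed₂ (T : ℕ → Finset (ι₀ × π)) (md m : ℕ → ι₀ × π → ℕ) (slot : ℕ → ι₀ × π → ℕ → Σ _ : ℕ, ℕ)
    (pol : ℕ → ι₀ × π → ℕ → Pol) (θ : ℕ → ι₀ × π → ℕ → ℝ) (uX : (K : ℕ) → (τ : ι₀ × π) → ℕ → Ω' K τ.1 → ℝ)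
    (ψ : ℕ → (Σ _ : ℕ, ℕ) → ι₀ × π → π) : Prop where
  /-- the patterned factors come first -/
  md_le : ∀ K, ∀ τ ∈ T K, md K τ ≤ m K τ
  /-- flips of terms are terms -/
  mem : ∀ K σ, ∀ τ ∈ T K, (τ.1, ψ K σ τ) ∈ T K
  /-- flipping twice is the identity on terms -/
  invol : ∀ K σ, ∀ τ ∈ T K, ψ K σ (τ.1, ψ K σ τ) = τ.2
  /-- the number of patterned factors is preserved -/
  md_eq : ∀ K σ, ∀ τ ∈ T K, md K (τ.1, ψ K σ τ) = md K τ
  /-- the number of factors is preserved -/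
  m_eq : ∀ K σ, ∀ τ ∈ T K, m K (τ.1, ψ K σ τ) = m K τ
  /-- slots are preserved -/
  slot_eq : ∀ K σ, ∀ τ ∈ T K, ∀ j < m K τ, slot K (τ.1, ψ K σ τ) j = slot K τ j
  /-- thresholds are preserved -/
  thr_eq : ∀ K σ, ∀ τ ∈ T K, ∀ j < m K τ, θ K (τ.1, ψ K σ τ) j = θ K τ j
  /-- tested variables are preserved -/
  var_eq : ∀ K σ, ∀ τ ∈ T K, ∀ j < m K τ, uX K (τ.1, ψ K σ τ) j = uX K τ j
  /-- polarities are preserved, except for a patterned factor in the slot … -/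
  pol_eq : ∀ K σ, ∀ τ ∈ T K, ∀ j < m K τ, ¬ (j < md K τ ∧ slot K τ j = σ) → pol K (τ.1, ψ K σ τ) j = pol K τ j
  /-- … whose polarity is flipped -/
  pol_flip : ∀ K σ, ∀ τ ∈ T K, ∀ j < md K τ, slot K τ j = σ → pol K (τ.1, ψ K σ τ) j = polFlip (pol K τ j)
  /-- one patterned factor per slot -/
  inj : ∀ K, ∀ τ ∈ T K, ∀ j < md K τ, ∀ j' < md K τ, slot K τ j = slot K τ j' → j = j'

variable {l₀ : ℝ} {T : ℕ → Finset (ι₀ × π)} {X : ℕ → ℝ → ι₀ × π → ℝ} {χ : ℕ → ℝ → ℝ} {κ Lχ : ℕ → ℝ} {N : ℕ} {n : ℕ → ℕ}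
  {μ : (K : ℕ) → (τ' : ι₀) → Measure (Ω' K τ')} {md m : ℕ → ι₀ × π → ℕ} {slot : ℕ → ι₀ × π → ℕ → Σ _ : ℕ, ℕ}
  {pol : ℕ → ι₀ × π → ℕ → Pol} {θ : ℕ → ι₀ × π → ℕ → ℝ} {uX uY : (K : ℕ) → (τ : ι₀ × π) → ℕ → Ω' K τ.1 → ℝ}
  {RX : (K : ℕ) → ℝ → (τ : ι₀ × π) → Ω' K τ.1 → ℝ} {ρ : ℕ → ℝ} {ψ : ℕ → (Σ _ : ℕ, ℕ) → ι₀ × π → π}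

/-- **PER TERM: the PATTERNED slot-`σ` sibling weight of `τ` is at most the weight of `τ` plus the weight of its `σ`-flip**, when the
remainder of the flipped term equals the remainder of the term almost everywhere.  (If `τ` has a patterned factor in slot `σ` —
exactly one, by (v) —: `sibAt ≤ sibling` pointwise (the shell indicator is `≤ 1`), `sibling = ∏ fac(τ) + ∏ fac(flip τ)` pointwise by
`T4AgeZeroLayer.sibling_eq_prod_add_prod` (every other factor, patterned or fixed, is unchanged), integrate against the common
remainder and read the two representations; if it has none the patterned sibling weight is `0`.) [folklore] -/
theorem sibWd_le_add_flip₂ (h : TermRepr l₀ T X χ κ Lχ N n (fun K τ => μ K τ.1) m slot pol θ uX uY RX)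
    (hφ : FlipClosed₂ T md m slot pol θ uX ψ) {K : ℕ} {σ : Σ _ : ℕ, ℕ} {t : ℝ} (ht : |t| ≤ l₀)
    (hR : ∀ τ ∈ T K, RX K t (τ.1, ψ K σ τ) =ᵐ[μ K τ.1] RX K t τ) {τ : ι₀ × π} (hτ : τ ∈ T K) :
    sibWd χ κ (fun K τ => μ K τ.1) md m slot pol θ uX RX ρ σ K t τ ≤ X K t τ + X K t (τ.1, ψ K σ τ) := by
  have hφτ : (τ.1, ψ K σ τ) ∈ T K := hφ.mem K σ τ hτ
  by_cases hex : ∃ i < md K τ, slot K τ i = σ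
  · obtain ⟨i, hi, hiσ⟩ := hex
    have him : i < m K τ := lt_of_lt_of_le hi (hφ.md_le K τ hτ)
    have hfilter : (range (md K τ)).filter (fun j => slot K τ j = σ) = {i} := by
      refine eq_singleton_iff_unique_mem.2 ⟨mem_filter.2 ⟨mem_range.2 hi, hiσ⟩, fun j hj => ?_⟩
      obtain ⟨hj, hjσ⟩ := mem_filter.1 hj
      exact hφ.inj K τ hτ j (mem_range.1 hj) i hi (hjσ.trans hiσ.symm)
    unfold sibWd
    rw [hfilter, sum_singleton]
    have hsib : ∀ v, sibling (facAt χ (slot K τ) (pol K τ) (θ K τ) (fun j => uX K τ j v)) (m K τ) i =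
        (∏ j ∈ range (m K τ), facAt χ (slot K τ) (pol K τ) (θ K τ) (fun j => uX K τ j v) j) +
          ∏ j ∈ range (m K (τ.1, ψ K σ τ)), facAt χ (slot K (τ.1, ψ K σ τ)) (pol K (τ.1, ψ K σ τ)) (θ K (τ.1, ψ K σ τ))
            (fun j => uX K (τ.1, ψ K σ τ) j v) j := by
      intro v
      rw [hφ.m_eq K σ τ hτ]
      refine sibling_eq_prod_add_prod him (fun j hj hji => ?_) ?_
      · have hne : ¬ (j < md K τ ∧ slot K τ j = σ) := fun hh => hji (hφ.inj K τ hτ j hh.1 i hi (hh.2.trans hiσ.symm))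
        simp only [facAt, hφ.slot_eq K σ τ hτ j hj, hφ.thr_eq K σ τ hτ j hj, hφ.var_eq K σ τ hτ j hj,
          hφ.pol_eq K σ τ hτ j hj hne]
      · simp only [facAt, hφ.slot_eq K σ τ hτ i him, hφ.thr_eq K σ τ hτ i him, hφ.var_eq K σ τ hτ i him,
          hφ.pol_flip K σ τ hτ i hi hiσ, fac_polFlip]
    have h0 : 0 ≤ᵐ[μ K τ.1] RX K t τ := h.rem_nonneg K t ht τ hτ
    have hIs : Integrable (fun v => sibAt χ κ (slot K τ) (pol K τ) (θ K τ) (fun j => uX K τ j v)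
        (ρ (K - (slot K τ i).1)) (m K τ) i * RX K t τ v) (μ K τ.1) := h.integrable_sib ht hτ him _
    have hIτ : Integrable (fun v => (∏ j ∈ range (m K τ), facAt χ (slot K τ) (pol K τ) (θ K τ) (fun j => uX K τ j v) j) *
        RX K t τ v) (μ K τ.1) := h.integrable_prod ht hτ
    have hIφ : Integrable (fun v => (∏ j ∈ range (m K (τ.1, ψ K σ τ)), facAt χ (slot K (τ.1, ψ K σ τ))
        (pol K (τ.1, ψ K σ τ)) (θ K (τ.1, ψ K σ τ)) (fun j => uX K (τ.1, ψ K σ τ) j v) j) * RX K t (τ.1, ψ K σ τ) v)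
        (μ K τ.1) := h.integrable_prod ht hφτ
    calc ∫ v, sibAt χ κ (slot K τ) (pol K τ) (θ K τ) (fun j => uX K τ j v) (ρ (K - (slot K τ i).1)) (m K τ) i *
            RX K t τ v ∂μ K τ.1
        ≤ ∫ v, ((∏ j ∈ range (m K τ), facAt χ (slot K τ) (pol K τ) (θ K τ) (fun j => uX K τ j v) j) * RX K t τ v +
            (∏ j ∈ range (m K (τ.1, ψ K σ τ)), facAt χ (slot K (τ.1, ψ K σ τ)) (pol K (τ.1, ψ K σ τ))
              (θ K (τ.1, ψ K σ τ)) (fun j => uX K (τ.1, ψ K σ τ) j v) j) * RX K t (τ.1, ψ K σ τ) v) ∂μ K τ.1 := by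
          refine integral_mono_ae hIs (hIτ.add hIφ) ?_
          filter_upwards [h0, hR τ hτ] with v hv hRv
          rw [hRv, ← add_mul, ← hsib v]
          unfold sibAt
          exact mul_le_mul_of_nonneg_right
            (mul_le_of_le_one_left (sibling_nonneg (fun j _ => facAt_nonneg h.profile j) him) (Pol.shell_le_one _ _ _ _ _))
            hv
      _ = X K t τ + X K t (τ.1, ψ K σ τ) := by
          rw [integral_add hIτ hIφ, h.repr K t ht τ hτ, h.repr K t ht _ hφτ]
  · have hfilter : (range (md K τ)).filter (fun j => slot K τ j = σ) = ∅ :=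
      filter_eq_empty_iff.2 fun j hj hjσ => hex ⟨j, mem_range.1 hj, hjσ⟩
    unfold sibWd
    rw [hfilter, sum_empty]
    exact add_nonneg (termRepr_nonneg h K t ht τ hτ) (termRepr_nonneg h K t ht _ hφτ)

/-- **PARTIAL FLIP-CLOSURE ⇒ SIBLING SUPPRESSION `2` ON THE PATTERNED PART** (mechanism (A) of `T4SiblingInsertion` §0 — conservation
at a decomposition of unity — at the `TermRepr` level): for every slot `σ` of the window, every `K` and every `|t| ≤ l₀`,
`Σ_{τ ∈ T K} sibWd_σ(τ) ≤ 2 · Σ_{τ ∈ T K} X K t τ` (per term `sibWd_le_add_flip₂`, then the flip is a bijection of `T K`).  NO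
estimate: positivity and reindexing only. [folklore] -/
theorem siblingSuppression_two_of_flip₂ (h : TermRepr l₀ T X χ κ Lχ N n (fun K τ => μ K τ.1) m slot pol θ uX uY RX)
    (hφ : FlipClosed₂ T md m slot pol θ uX ψ)
    (hR : ∀ K σ t, |t| ≤ l₀ → ∀ τ ∈ T K, RX K t (τ.1, ψ K σ τ) =ᵐ[μ K τ.1] RX K t τ) :
    SiblingSuppression l₀ T X N n (sibWd χ κ (fun K τ => μ K τ.1) md m slot pol θ uX RX ρ) (fun _ => 2) := by
  intro σ _ K t ht
  show _ ≤ 2 * ∑ τ ∈ T K, X K t τ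
  have hre : ∑ τ ∈ T K, X K t (τ.1, ψ K σ τ) = ∑ τ ∈ T K, X K t τ :=
    sum_nbij' (fun τ => (τ.1, ψ K σ τ)) (fun τ => (τ.1, ψ K σ τ)) (hφ.mem K σ) (hφ.mem K σ)
      (fun τ hτ => Prod.ext rfl (hφ.invol K σ τ hτ)) (fun τ hτ => Prod.ext rfl (hφ.invol K σ τ hτ)) fun _ _ => rfl
  calc ∑ τ ∈ T K, sibWd χ κ (fun K τ => μ K τ.1) md m slot pol θ uX RX ρ σ K t τ
      ≤ ∑ τ ∈ T K, (X K t τ + X K t (τ.1, ψ K σ τ)) :=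
        sum_le_sum fun τ hτ => sibWd_le_add_flip₂ h hφ ht (hR K σ t ht) hτ
    _ = ∑ τ ∈ T K, X K t τ + ∑ τ ∈ T K, X K t (τ.1, ψ K σ τ) := sum_add_distrib
    _ = 2 * ∑ τ ∈ T K, X K t τ := by rw [hre]; ring

/-- **PARTIAL FLIP-CLOSURE + ANY BOUND ON THE FIXED PART ⇒ SIBLING SUPPRESSION `2 + S_f` FOR THE WHOLE SLOT** (the sum form of
`T4SiblingInsertion.siblingSuppression_add`: `sibW = sibWd + sibWf`, the patterned part bounded by `2`, the fixed part by `S_f`).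
[folklore] -/
theorem siblingSuppression_of_flip₂_add (h : TermRepr l₀ T X χ κ Lχ N n (fun K τ => μ K τ.1) m slot pol θ uX uY RX)
    (hφ : FlipClosed₂ T md m slot pol θ uX ψ)
    (hR : ∀ K σ t, |t| ≤ l₀ → ∀ τ ∈ T K, RX K t (τ.1, ψ K σ τ) =ᵐ[μ K τ.1] RX K t τ) {Sf : ℕ → ℝ}
    (hf : SiblingSuppression l₀ T X N n (sibWf χ κ (fun K τ => μ K τ.1) md m slot pol θ uX RX ρ) Sf) :
    SiblingSuppression l₀ T X N n (sibW χ κ (fun K τ => μ K τ.1) m slot pol θ uX RX ρ) (fun a => 2 + Sf a) := by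
  intro σ hσ K t ht
  have hd := siblingSuppression_two_of_flip₂ (ρ := ρ) h hφ hR σ hσ K t ht
  have hf' := hf σ hσ K t ht
  calc ∑ τ ∈ T K, sibW χ κ (fun K τ => μ K τ.1) m slot pol θ uX RX ρ σ K t τ
      = ∑ τ ∈ T K, sibWd χ κ (fun K τ => μ K τ.1) md m slot pol θ uX RX ρ σ K t τ +
          ∑ τ ∈ T K, sibWf χ κ (fun K τ => μ K τ.1) md m slot pol θ uX RX ρ σ K t τ := by
        rw [← sum_add_distrib]
        exact sum_congr rfl fun τ hτ => sibW_eq_sibWd_add_sibWf (hφ.md_le K τ hτ)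
    _ ≤ 2 * ∑ τ ∈ T K, X K t τ + Sf σ.1 * ∑ τ ∈ T K, X K t τ := add_le_add hd hf'
    _ = (2 + Sf σ.1) * ∑ τ ∈ T K, X K t τ := by ring

end Flip

/-! ## §4 The pattern layer over an older-history family: schema, representation, neutrality, flip-closure -/

section Layer

variable {ι₀ : Type*}

/-- THE LAYER OVER A SET OF OLDER HISTORIES: `τ' ∈ B` × the polarity patterns `S ⊆ range (md τ')` of its patterned block. [folklore] -/
def layerOver (B : Finset ι₀) (md : ι₀ → ℕ) : Finset (ι₀ × Finset ℕ) :=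
  (B.sigma fun τ' => (range (md τ')).powerset).map (Equiv.sigmaEquivProd ι₀ (Finset ℕ)).toEmbedding

/-- membership in the layer over a set. [folklore] -/
theorem mem_layerOver {B : Finset ι₀} {md : ι₀ → ℕ} {τ : ι₀ × Finset ℕ} :
    τ ∈ layerOver B md ↔ τ.1 ∈ B ∧ τ.2 ⊆ range (md τ.1) := by
  rw [layerOver, mem_map_equiv, mem_sigma, mem_powerset]
  exact Iff.rfl

/-- the layer is monotone in the set of older histories. [folklore] -/
theorem layerOver_mono {B B' : Finset ι₀} (h : B ⊆ B') (md : ι₀ → ℕ) : layerOver B md ⊆ layerOver B' md := fun _ hτ =>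
  mem_layerOver.2 ⟨h (mem_layerOver.1 hτ).1, (mem_layerOver.1 hτ).2⟩

/-- **SUMS OVER THE LAYER ARE ITERATED SUMS**: older histories outside, patterns inside. [folklore] -/
theorem sum_layerOver {M : Type*} [AddCommMonoid M] (B : Finset ι₀) (md : ι₀ → ℕ) (f : ι₀ × Finset ℕ → M) :
    ∑ τ ∈ layerOver B md, f τ = ∑ τ' ∈ B, ∑ S ∈ (range (md τ')).powerset, f (τ', S) := by
  rw [layerOver, sum_map, sum_sigma]
  exact sum_congr rfl fun τ' _ => sum_congr rfl fun S _ => rfl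

/-- THE LAYERED TERM FAMILY: older histories `τ' ∈ T₀ K` × the `2^{md K τ'}` polarity patterns of their patterned blocks. [folklore] -/
def layerT₂ (T₀ : ℕ → Finset ι₀) (md : ℕ → ι₀ → ℕ) (K : ℕ) : Finset (ι₀ × Finset ℕ) := layerOver (T₀ K) (md K)

/-- membership in the layered family. [folklore] -/
theorem mem_layerT₂ {T₀ : ℕ → Finset ι₀} {md : ℕ → ι₀ → ℕ} {K : ℕ} {τ : ι₀ × Finset ℕ} :
    τ ∈ layerT₂ T₀ md K ↔ τ.1 ∈ T₀ K ∧ τ.2 ⊆ range (md K τ.1) :=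
  mem_layerOver

/-- a pattern-free count (of patterned factors `md`, or of all factors `m₀`) read on layered terms. [folklore] -/
abbrev layerM₂ (m₀ : ℕ → ι₀ → ℕ) : ℕ → ι₀ × Finset ℕ → ℕ := fun K τ => m₀ K τ.1

/-- the slots of a layered term: those of its older history's declared factors (pattern-free). [folklore] -/
abbrev layerSlot₂ (slot₀ : ℕ → ι₀ → ℕ → Σ _ : ℕ, ℕ) : ℕ → ι₀ × Finset ℕ → ℕ → Σ _ : ℕ, ℕ := fun K τ i => slot₀ K τ.1 i

/-- the polarities of a layered term: read off the pattern on the patterned block, fixed behind it. [folklore] -/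
abbrev layerPol₂ (md : ℕ → ι₀ → ℕ) (fpol : ℕ → ι₀ → ℕ → Pol) : ℕ → ι₀ × Finset ℕ → ℕ → Pol :=
  fun K τ i => if i < md K τ.1 then patPol τ.2 i else fpol K τ.1 i

/-- the window tested variables of a layered term: the declared functionals of its older history on ITS window (pattern-free;
the window space depends on the term through the older history only). [folklore] -/
abbrev layerVar₂ {Ωw : ι₀ → Type*} (v : (K : ℕ) → (τ' : ι₀) → ℕ → Ωw τ' → ℝ) :
    (K : ℕ) → (τ : ι₀ × Finset ℕ) → ℕ → Ωw τ.1 → ℝ := fun K τ i => v K τ.1 i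

/-- THE PATTERN RELABELLING OF THE FLIP at slot `σ`: toggle, in the pattern, the patterned positions sitting in slot `σ` (none or
exactly one when `slot₀` is injective on the patterned block). [folklore] -/
def layerPsi (md : ℕ → ι₀ → ℕ) (slot₀ : ℕ → ι₀ → ℕ → Σ _ : ℕ, ℕ) (K : ℕ) (σ : Σ _ : ℕ, ℕ) (τ : ι₀ × Finset ℕ) : Finset ℕ :=
  τ.2 ∆ ((range (md K τ.1)).filter fun i => slot₀ K τ.1 i = σ)

/-- **THE LAYERED FAMILY IS PARTIALLY FLIP-CLOSED** (§3 `FlipClosed₂`), for any window spaces and functionals, given `md ≤ m₀` and the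
injectivity of `slot₀` on the patterned block. [folklore] -/
theorem flipClosed_layer₂ {Ωw : ℕ → ι₀ → Type*} (T₀ : ℕ → Finset ι₀) {md m₀ : ℕ → ι₀ → ℕ}
    (hmd : ∀ K, ∀ τ' ∈ T₀ K, md K τ' ≤ m₀ K τ') (slot₀ : ℕ → ι₀ → ℕ → Σ _ : ℕ, ℕ)
    (hinj : ∀ K, ∀ τ' ∈ T₀ K, ∀ j < md K τ', ∀ j' < md K τ', slot₀ K τ' j = slot₀ K τ' j' → j = j')
    (fpol : ℕ → ι₀ → ℕ → Pol) (θ₀ : ℕ → ι₀ → ℕ → ℝ) (v : (K : ℕ) → (τ' : ι₀) → ℕ → Ωw K τ' → ℝ) :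
    FlipClosed₂ (Ω' := Ωw) (layerT₂ T₀ md) (layerM₂ md) (layerM₂ m₀) (layerSlot₂ slot₀) (layerPol₂ md fpol) (layerThr θ₀)
      (fun K τ i => v K τ.1 i) (layerPsi md slot₀) where
  md_le K τ hτ := hmd K τ.1 (mem_layerT₂.1 hτ).1
  mem K σ τ hτ := by
    obtain ⟨h1, h2⟩ := mem_layerT₂.1 hτ
    exact mem_layerT₂.2 ⟨h1, symmDiff_subset_of_subset₂ h2 (filter_subset _ _)⟩
  invol K σ τ _ := by
    show (τ.2 ∆ ((range (md K τ.1)).filter fun i => slot₀ K τ.1 i = σ)) ∆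
        ((range (md K τ.1)).filter fun i => slot₀ K τ.1 i = σ) = τ.2
    exact symmDiff_symmDiff_cancel_right _ _
  md_eq K σ τ _ := rfl
  m_eq K σ τ _ := rfl
  slot_eq K σ τ _ j _ := rfl
  thr_eq K σ τ _ j _ := rfl
  var_eq K σ τ _ j _ := rfl
  pol_eq K σ τ _ j hj hne := by
    show (if j < md K τ.1 then patPol (layerPsi md slot₀ K σ τ) j else fpol K τ.1 j) =
      if j < md K τ.1 then patPol τ.2 j else fpol K τ.1 j
    split_ifs with hjd
    · exact patPol_symmDiff_of_not_mem fun hP => hne ⟨hjd, (mem_filter.1 hP).2⟩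
    · rfl
  pol_flip K σ τ _ j hj hjσ := by
    show (if j < md K τ.1 then patPol (layerPsi md slot₀ K σ τ) j else fpol K τ.1 j) =
      polFlip (if j < md K τ.1 then patPol τ.2 j else fpol K τ.1 j)
    rw [if_pos hj, if_pos hj]
    exact patPol_symmDiff_of_mem (mem_filter.2 ⟨mem_range.2 hj, hjσ⟩)
  inj K τ hτ j hj j' hj' hjj := hinj K τ.1 (mem_layerT₂.1 hτ).1 j hj j' hj' hjj

/-- pointwise, the `2^{md}` patterned factor products over one older history total the fixed block's product (§1
`sum_powerset_prod_mixed` read through `facAt`). [folklore] -/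
theorem sum_powerset_prod_facAt_layerPol₂ (χ : ℕ → ℝ → ℝ) {md m₀ : ℕ → ι₀ → ℕ} (slot₀ : ℕ → ι₀ → ℕ → Σ _ : ℕ, ℕ)
    (fpol : ℕ → ι₀ → ℕ → Pol) (θ₀ : ℕ → ι₀ → ℕ → ℝ) {K : ℕ} {τ' : ι₀} (hmd : md K τ' ≤ m₀ K τ') (u : ℕ → ℝ) :
    ∑ S ∈ (range (md K τ')).powerset,
        ∏ i ∈ range (m₀ K τ'), facAt χ (slot₀ K τ') (layerPol₂ md fpol K (τ', S)) (θ₀ K τ') u i =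
      ∏ i ∈ Ico (md K τ') (m₀ K τ'), facAt χ (slot₀ K τ') (fpol K τ') (θ₀ K τ') u i :=
  sum_powerset_prod_mixed hmd (fpol K τ') fun i => χ (slot₀ K τ' i).1 (u i / θ₀ K τ' i)

variable {N : ℕ} [NeZero N] (F : T4Family)

/-- Bałaban's exp-mean-log small-plaquette average (0.4) on `SU(N)` (`ExpMeanLog.expMeanLogSU`). -/
local notation "EML" => (expMeanLogSU : LoopAverage (SU N))

/-- **THE TERM WEIGHT OF A LAYERED TERM, DEFINED** as its representing integral on run `K_X`'s finest level: all declared factors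
(patterned polarities read off the pattern, fixed ones as given) of the window functionals along the old transport to the window of
depth `NW₀ τ'`, times the older history's weight, against the run's product Haar measure. [folklore] -/
noncomputable def layerX₂ (χ : ℕ → ℝ → ℝ) (NW₀ : ι₀ → ℕ) (md m₀ : ℕ → ι₀ → ℕ) (slot₀ : ℕ → ι₀ → ℕ → Σ _ : ℕ, ℕ)
    (fpol : ℕ → ι₀ → ℕ → Pol) (θ₀ : ℕ → ι₀ → ℕ → ℝ) (v : (K : ℕ) → (τ' : ι₀) → ℕ → GaugeField (F.P (NW₀ τ')) 0 (SU N) → ℝ)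
    (KX : ℕ → ℕ) (R : (K : ℕ) → ℝ → ι₀ → GaugeField (F.P (KX K)) 0 (SU N) → ℝ) (K : ℕ) (t : ℝ) (τ : ι₀ × Finset ℕ) : ℝ :=
  ∫ U, (∏ i ∈ range (m₀ K τ.1), facAt χ (slot₀ K τ.1) (layerPol₂ md fpol K τ) (θ₀ K τ.1)
      (fun j => v K τ.1 j (oldTr F EML (KX K) (NW₀ τ.1) U)) i) * R K t τ.1 U ∂fieldMeasure (F.P (KX K)) 0 (SU N)

/-- **THE FIXED-BLOCK WEIGHT OF AN OLDER HISTORY**: the fixed factors only, times the older history's weight — what the patterns over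
the older history total (`sum_patterns_layerX₂`). [folklore] -/
noncomputable def fixW (χ : ℕ → ℝ → ℝ) (NW₀ : ι₀ → ℕ) (md m₀ : ℕ → ι₀ → ℕ) (slot₀ : ℕ → ι₀ → ℕ → Σ _ : ℕ, ℕ)
    (fpol : ℕ → ι₀ → ℕ → Pol) (θ₀ : ℕ → ι₀ → ℕ → ℝ) (v : (K : ℕ) → (τ' : ι₀) → ℕ → GaugeField (F.P (NW₀ τ')) 0 (SU N) → ℝ)
    (KX : ℕ → ℕ) (R : (K : ℕ) → ℝ → ι₀ → GaugeField (F.P (KX K)) 0 (SU N) → ℝ) (K : ℕ) (t : ℝ) (τ' : ι₀) : ℝ :=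
  ∫ U, (∏ i ∈ Ico (md K τ') (m₀ K τ'), facAt χ (slot₀ K τ') (fpol K τ') (θ₀ K τ')
      (fun j => v K τ' j (oldTr F EML (KX K) (NW₀ τ') U)) i) * R K t τ' U ∂fieldMeasure (F.P (KX K)) 0 (SU N)

/-- **THE FIXED BLOCK'S SIBLING WEIGHT OF A LAYERED TERM ON THE WINDOW** (§2 `sibWf` of the layer's window representation, whose
remainder is the old density of the older history's weight): the object the caller's suppression binder `S_f` bounds. [folklore] -/
@[reducible] noncomputable def layerSibWf (χ : ℕ → ℝ → ℝ) (κ : ℕ → ℝ) (NW₀ : ι₀ → ℕ) (md m₀ : ℕ → ι₀ → ℕ)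
    (slot₀ : ℕ → ι₀ → ℕ → Σ _ : ℕ, ℕ) (fpol : ℕ → ι₀ → ℕ → Pol) (θ₀ : ℕ → ι₀ → ℕ → ℝ)
    (v : (K : ℕ) → (τ' : ι₀) → ℕ → GaugeField (F.P (NW₀ τ')) 0 (SU N) → ℝ) (KX : ℕ → ℕ)
    (R : (K : ℕ) → ℝ → ι₀ → GaugeField (F.P (KX K)) 0 (SU N) → ℝ) (ρ : ℕ → ℝ) :
    (Σ _ : ℕ, ℕ) → ℕ → ℝ → ι₀ × Finset ℕ → ℝ :=
  sibWf χ κ (fun _ τ => fieldMeasure (F.P (NW₀ τ.1)) 0 (SU N)) (layerM₂ md) (layerM₂ m₀) (layerSlot₂ slot₀) (layerPol₂ md fpol)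
    (layerThr θ₀) (layerVar₂ v) (fun K t τ V => (oldDensity F EML (KX K) (NW₀ τ.1) (R K t τ.1) V : ℝ)) ρ

variable {l₀ : ℝ} {T₀ : ℕ → Finset ι₀} {χ : ℕ → ℝ → ℝ} {κ Lχ : ℕ → ℝ} {N₀ : ℕ} {n : ℕ → ℕ} {NW₀ : ι₀ → ℕ} {md m₀ : ℕ → ι₀ → ℕ}
  {slot₀ : ℕ → ι₀ → ℕ → Σ _ : ℕ, ℕ} {fpol : ℕ → ι₀ → ℕ → Pol} {θ₀ : ℕ → ι₀ → ℕ → ℝ}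
  {vX vY : (K : ℕ) → (τ' : ι₀) → ℕ → GaugeField (F.P (NW₀ τ')) 0 (SU N) → ℝ}

/-- **THE LAYERED FAMILY IS REPRESENTED ON RUN `K_X`'S FINEST LEVEL** in the shape of `T4FinestToWindow.cauchy_of_finest`'s binders
`hA`/`hB` with window depth `fun τ ↦ NW₀ τ.1`: profiles Lipschitz, thresholds positive, slots in the window of ages `≤ N₀` with `< n a`
copies and of age `≤ K`, window functionals measurable, older-history weights a.e. nonnegative and integrable — the representation
itself holds BY DEFINITION of `layerX₂`. [folklore] -/
theorem termRepr_layer₂ (KX : ℕ → ℕ) (hχ : ∀ a, LipProfile (χ a) (κ a) (Lχ a))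
    (hθ : ∀ K, ∀ τ' ∈ T₀ K, ∀ i < m₀ K τ', 0 < θ₀ K τ' i)
    (hwin : ∀ K, ∀ τ' ∈ T₀ K, ∀ i < m₀ K τ', slot₀ K τ' i ∈ (range (N₀ + 1)).sigma fun a => range (n a))
    (hband : ∀ K, ∀ τ' ∈ T₀ K, ∀ i < m₀ K τ', (slot₀ K τ' i).1 ≤ K)
    (hv : ∀ K, ∀ τ' ∈ T₀ K, ∀ i < m₀ K τ', Measurable (vX K τ' i) ∧ Measurable (vY K τ' i))
    {RX : (K : ℕ) → ℝ → ι₀ → GaugeField (F.P (KX K)) 0 (SU N) → ℝ}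
    (hR0 : ∀ K t, |t| ≤ l₀ → ∀ τ' ∈ T₀ K, 0 ≤ᵐ[fieldMeasure (F.P (KX K)) 0 (SU N)] RX K t τ')
    (hRi : ∀ K t, |t| ≤ l₀ → ∀ τ' ∈ T₀ K, Integrable (RX K t τ') (fieldMeasure (F.P (KX K)) 0 (SU N))) :
    TermRepr l₀ (layerT₂ T₀ md) (layerX₂ F χ NW₀ md m₀ slot₀ fpol θ₀ vX KX RX) χ κ Lχ N₀ n
      (fun K _ => fieldMeasure (F.P (KX K)) 0 (SU N)) (layerM₂ m₀) (layerSlot₂ slot₀) (layerPol₂ md fpol) (layerThr θ₀)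
      (fun K τ i U => layerVar₂ vX K τ i (oldTr F EML (KX K) ((fun τ : ι₀ × Finset ℕ => NW₀ τ.1) τ) U))
      (fun K τ i U => layerVar₂ vY K τ i (oldTr F EML (KX K) ((fun τ : ι₀ × Finset ℕ => NW₀ τ.1) τ) U)) (layerRem RX) where
  profile := hχ
  thr_pos K τ hτ i hi := hθ K τ.1 (mem_layerT₂.1 hτ).1 i hi
  slot_mem K τ hτ i hi := hwin K τ.1 (mem_layerT₂.1 hτ).1 i hi
  slot_band K τ hτ i hi := hband K τ.1 (mem_layerT₂.1 hτ).1 i hi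
  meas K τ hτ i hi :=
    ⟨(hv K τ.1 (mem_layerT₂.1 hτ).1 i hi).1.comp (measurable_oldTr_SUN F (KX K) (NW₀ τ.1)),
      (hv K τ.1 (mem_layerT₂.1 hτ).1 i hi).2.comp (measurable_oldTr_SUN F (KX K) (NW₀ τ.1))⟩
  rem_nonneg K t ht τ hτ := hR0 K t ht τ.1 (mem_layerT₂.1 hτ).1
  rem_int K t ht τ hτ := hRi K t ht τ.1 (mem_layerT₂.1 hτ).1
  repr _ _ _ _ _ := rfl

/-- **RUN A** (cutoff `K`): the binder `hA` of `cauchy_of_finest` with `NW := fun τ ↦ NW₀ τ.1`, inhabited. [folklore] -/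
theorem termRepr_layer₂_A (hχ : ∀ a, LipProfile (χ a) (κ a) (Lχ a))
    (hθ : ∀ K, ∀ τ' ∈ T₀ K, ∀ i < m₀ K τ', 0 < θ₀ K τ' i)
    (hwin : ∀ K, ∀ τ' ∈ T₀ K, ∀ i < m₀ K τ', slot₀ K τ' i ∈ (range (N₀ + 1)).sigma fun a => range (n a))
    (hband : ∀ K, ∀ τ' ∈ T₀ K, ∀ i < m₀ K τ', (slot₀ K τ' i).1 ≤ K)
    (hv : ∀ K, ∀ τ' ∈ T₀ K, ∀ i < m₀ K τ', Measurable (vX K τ' i) ∧ Measurable (vY K τ' i))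
    {RA : (K : ℕ) → ℝ → ι₀ → GaugeField (F.P K) 0 (SU N) → ℝ}
    (hR0 : ∀ K t, |t| ≤ l₀ → ∀ τ' ∈ T₀ K, 0 ≤ᵐ[fieldMeasure (F.P K) 0 (SU N)] RA K t τ')
    (hRi : ∀ K t, |t| ≤ l₀ → ∀ τ' ∈ T₀ K, Integrable (RA K t τ') (fieldMeasure (F.P K) 0 (SU N))) :
    TermRepr l₀ (layerT₂ T₀ md) (layerX₂ F χ NW₀ md m₀ slot₀ fpol θ₀ vX (fun K => K) RA) χ κ Lχ N₀ n
      (fun K _ => fieldMeasure (F.P K) 0 (SU N)) (layerM₂ m₀) (layerSlot₂ slot₀) (layerPol₂ md fpol) (layerThr θ₀)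
      (fun K τ i U => layerVar₂ vX K τ i (oldTr F EML K ((fun τ : ι₀ × Finset ℕ => NW₀ τ.1) τ) U))
      (fun K τ i U => layerVar₂ vY K τ i (oldTr F EML K ((fun τ : ι₀ × Finset ℕ => NW₀ τ.1) τ) U)) (layerRem RA) :=
  termRepr_layer₂ F (fun K => K) hχ hθ hwin hband hv hR0 hRi

/-- **RUN B** (cutoff `K + 1`): the binder `hB` of `cauchy_of_finest` with `NW := fun τ ↦ NW₀ τ.1`, inhabited. [folklore] -/
theorem termRepr_layer₂_B (hχ : ∀ a, LipProfile (χ a) (κ a) (Lχ a))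
    (hθ : ∀ K, ∀ τ' ∈ T₀ K, ∀ i < m₀ K τ', 0 < θ₀ K τ' i)
    (hwin : ∀ K, ∀ τ' ∈ T₀ K, ∀ i < m₀ K τ', slot₀ K τ' i ∈ (range (N₀ + 1)).sigma fun a => range (n a))
    (hband : ∀ K, ∀ τ' ∈ T₀ K, ∀ i < m₀ K τ', (slot₀ K τ' i).1 ≤ K)
    (hv : ∀ K, ∀ τ' ∈ T₀ K, ∀ i < m₀ K τ', Measurable (vX K τ' i) ∧ Measurable (vY K τ' i))
    {RB : (K : ℕ) → ℝ → ι₀ → GaugeField (F.P (K + 1)) 0 (SU N) → ℝ}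
    (hR0 : ∀ K t, |t| ≤ l₀ → ∀ τ' ∈ T₀ K, 0 ≤ᵐ[fieldMeasure (F.P (K + 1)) 0 (SU N)] RB K t τ')
    (hRi : ∀ K t, |t| ≤ l₀ → ∀ τ' ∈ T₀ K, Integrable (RB K t τ') (fieldMeasure (F.P (K + 1)) 0 (SU N))) :
    TermRepr l₀ (layerT₂ T₀ md) (layerX₂ F χ NW₀ md m₀ slot₀ fpol θ₀ vX (fun K => K + 1) RB) χ κ Lχ N₀ n
      (fun K _ => fieldMeasure (F.P (K + 1)) 0 (SU N)) (layerM₂ m₀) (layerSlot₂ slot₀) (layerPol₂ md fpol) (layerThr θ₀)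
      (fun K τ i U => layerVar₂ vX K τ i (oldTr F EML (K + 1) ((fun τ : ι₀ × Finset ℕ => NW₀ τ.1) τ) U))
      (fun K τ i U => layerVar₂ vY K τ i (oldTr F EML (K + 1) ((fun τ : ι₀ × Finset ℕ => NW₀ τ.1) τ) U)) (layerRem RB) :=
  termRepr_layer₂ F (fun K => K + 1) hχ hθ hwin hband hv hR0 hRi

/-- **NEUTRALITY OVER ONE OLDER HISTORY**: the `2^{md K τ'}` pattern weights over `τ'` total its FIXED-BLOCK WEIGHT `fixW … K t τ'`
(the mixed decomposition of unity under the integral sign).  Only measurability / integrability / `md ≤ m₀` are used. [folklore] -/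
theorem sum_patterns_layerX₂ (KX : ℕ → ℕ) (hχ : ∀ a, LipProfile (χ a) (κ a) (Lχ a))
    (hmd : ∀ K, ∀ τ' ∈ T₀ K, md K τ' ≤ m₀ K τ')
    (hv : ∀ K, ∀ τ' ∈ T₀ K, ∀ i < m₀ K τ', Measurable (vX K τ' i) ∧ Measurable (vY K τ' i))
    {RX : (K : ℕ) → ℝ → ι₀ → GaugeField (F.P (KX K)) 0 (SU N) → ℝ}
    (hRi : ∀ K t, |t| ≤ l₀ → ∀ τ' ∈ T₀ K, Integrable (RX K t τ') (fieldMeasure (F.P (KX K)) 0 (SU N)))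
    (K : ℕ) {t : ℝ} (ht : |t| ≤ l₀) {τ' : ι₀} (hτ' : τ' ∈ T₀ K) :
    ∑ S ∈ (range (md K τ')).powerset, layerX₂ F χ NW₀ md m₀ slot₀ fpol θ₀ vX KX RX K t (τ', S) =
      fixW F χ NW₀ md m₀ slot₀ fpol θ₀ vX KX RX K t τ' := by
  have hI : ∀ S ∈ (range (md K τ')).powerset, Integrable (fun U => (∏ i ∈ range (m₀ K τ'),
      facAt χ (slot₀ K τ') (layerPol₂ md fpol K (τ', S)) (θ₀ K τ') (fun j => vX K τ' j (oldTr F EML (KX K) (NW₀ τ') U)) i) *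
        RX K t τ' U) (fieldMeasure (F.P (KX K)) 0 (SU N)) := fun S _ =>
    integrable_unitInterval_mul (hRi K t ht τ' hτ')
      (Finset.measurable_prod _ fun i hi =>
        measurable_facAt hχ ((hv K τ' hτ' i (mem_range.1 hi)).1.comp (measurable_oldTr_SUN F (KX K) (NW₀ τ'))))
      (fun _ => prod_nonneg fun i _ => facAt_nonneg hχ i) fun _ => prod_facAt_le_one hχ
  unfold layerX₂ fixW
  rw [← integral_finsetSum _ hI]
  refine integral_congr_ae (ae_of_all _ fun U => ?_)
  show ∑ S ∈ (range (md K τ')).powerset, (∏ i ∈ range (m₀ K τ'),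
      facAt χ (slot₀ K τ') (layerPol₂ md fpol K (τ', S)) (θ₀ K τ') (fun j => vX K τ' j (oldTr F EML (KX K) (NW₀ τ') U)) i) *
        RX K t τ' U =
    (∏ i ∈ Ico (md K τ') (m₀ K τ'),
      facAt χ (slot₀ K τ') (fpol K τ') (θ₀ K τ') (fun j => vX K τ' j (oldTr F EML (KX K) (NW₀ τ') U)) i) * RX K t τ' U
  rw [← sum_mul, sum_powerset_prod_facAt_layerPol₂ χ slot₀ fpol θ₀ (hmd K τ' hτ')]

/-- **NEUTRALITY OF THE LAYER**: over any set `B₀ ⊆ T₀ K` of older histories, the layered weights total the fixed-block weights.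
[folklore] -/
theorem sum_layerOver_layerX₂ (KX : ℕ → ℕ) (hχ : ∀ a, LipProfile (χ a) (κ a) (Lχ a))
    (hmd : ∀ K, ∀ τ' ∈ T₀ K, md K τ' ≤ m₀ K τ')
    (hv : ∀ K, ∀ τ' ∈ T₀ K, ∀ i < m₀ K τ', Measurable (vX K τ' i) ∧ Measurable (vY K τ' i))
    {RX : (K : ℕ) → ℝ → ι₀ → GaugeField (F.P (KX K)) 0 (SU N) → ℝ}
    (hRi : ∀ K t, |t| ≤ l₀ → ∀ τ' ∈ T₀ K, Integrable (RX K t τ') (fieldMeasure (F.P (KX K)) 0 (SU N)))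
    (K : ℕ) {t : ℝ} (ht : |t| ≤ l₀) {B₀ : Finset ι₀} (hB₀ : B₀ ⊆ T₀ K) :
    ∑ τ ∈ layerOver B₀ (md K), layerX₂ F χ NW₀ md m₀ slot₀ fpol θ₀ vX KX RX K t τ =
      ∑ τ' ∈ B₀, fixW F χ NW₀ md m₀ slot₀ fpol θ₀ vX KX RX K t τ' := by
  rw [sum_layerOver]
  exact sum_congr rfl fun τ' hτ' => sum_patterns_layerX₂ F KX hχ hmd hv hRi K ht (hB₀ hτ')

/-- **THE BAD-CLASS BOUND TRANSFERS**: if the older family's bad class has relative FIXED-BLOCK weight `≤ W K` in each run, so does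
the layered family's class "older history bad, any pattern" (neutrality in numerator and denominator). [folklore] -/
theorem relWeightBound_layer₂ {A B : ℕ → ℝ → ι₀ × Finset ℕ → ℝ} {A₀ B₀ : ℕ → ℝ → ι₀ → ℝ} {Bad₀ : ℕ → ℝ → Finset ι₀}
    {W : ℕ → ℝ} (hW : RelWeightBound l₀ T₀ A₀ B₀ Bad₀ W)
    (hA : ∀ K t, |t| ≤ l₀ → ∀ B' ⊆ T₀ K, ∑ τ ∈ layerOver B' (md K), A K t τ = ∑ τ' ∈ B', A₀ K t τ')
    (hB : ∀ K t, |t| ≤ l₀ → ∀ B' ⊆ T₀ K, ∑ τ ∈ layerOver B' (md K), B K t τ = ∑ τ' ∈ B', B₀ K t τ') :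
    RelWeightBound l₀ (layerT₂ T₀ md) A B (fun K t => layerOver (Bad₀ K t) (md K)) W where
  bad_subset K t ht := layerOver_mono (hW.bad_subset K t ht) _
  nonneg := hW.nonneg
  lt_one := hW.lt_one
  summable := hW.summable
  bad_left K t ht := by
    show _ ≤ W K * ∑ τ ∈ layerOver (T₀ K) (md K), A K t τ
    rw [hA K t ht _ (hW.bad_subset K t ht), hA K t ht _ subset_rfl]
    exact hW.bad_left K t ht
  bad_right K t ht := by
    show _ ≤ W K * ∑ τ ∈ layerOver (T₀ K) (md K), B K t τ
    rw [hB K t ht _ (hW.bad_subset K t ht), hB K t ht _ subset_rfl]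
    exact hW.bad_right K t ht

/-- **SIBLING SUPPRESSION `2 + S_f` FOR THE LAYER ON THE WINDOW** (the shape of `cauchy_of_finest`'s binders `hSA`/`hSB` with
`NW := fun τ ↦ NW₀ τ.1`): from the window representation delivered by the socket (`termRepr_window_of_finest`) — whose remainder, the old
density of the older history's weight, is PATTERN-FREE — the patterned part is bounded by `2` (§3 with `flipClosed_layer₂`) and the fixed
part by the BINDER `hfix`. [folklore] -/
theorem siblingSuppression_layer₂ (KX : ℕ → ℕ) {X : ℕ → ℝ → ι₀ × Finset ℕ → ℝ}
    {RX : (K : ℕ) → ℝ → ι₀ → GaugeField (F.P (KX K)) 0 (SU N) → ℝ} {ρ Sf : ℕ → ℝ}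
    (hmd : ∀ K, ∀ τ' ∈ T₀ K, md K τ' ≤ m₀ K τ')
    (hinj : ∀ K, ∀ τ' ∈ T₀ K, ∀ j < md K τ', ∀ j' < md K τ', slot₀ K τ' j = slot₀ K τ' j' → j = j')
    (hw : TermRepr l₀ (layerT₂ T₀ md) X χ κ Lχ N₀ n (fun _ τ => fieldMeasure (F.P (NW₀ τ.1)) 0 (SU N)) (layerM₂ m₀)
      (layerSlot₂ slot₀) (layerPol₂ md fpol) (layerThr θ₀) (layerVar₂ vX) (layerVar₂ vY)
      (fun K t τ V => (oldDensity F EML (KX K) (NW₀ τ.1) (layerRem RX K t τ) V : ℝ)))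
    (hfix : SiblingSuppression l₀ (layerT₂ T₀ md) X N₀ n (layerSibWf F χ κ NW₀ md m₀ slot₀ fpol θ₀ vX KX RX ρ) Sf) :
    SiblingSuppression l₀ (layerT₂ T₀ md) X N₀ n
      (sibW χ κ (fun _ τ => fieldMeasure (F.P (NW₀ τ.1)) 0 (SU N)) (layerM₂ m₀) (layerSlot₂ slot₀) (layerPol₂ md fpol)
        (layerThr θ₀) (layerVar₂ vX) (fun K t τ V => (oldDensity F EML (KX K) (NW₀ τ.1) (layerRem RX K t τ) V : ℝ)) ρ)
      (fun a => 2 + Sf a) :=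
  siblingSuppression_of_flip₂_add (Ω' := fun _ τ' => GaugeField (F.P (NW₀ τ')) 0 (SU N))
    (μ := fun _ τ' => fieldMeasure (F.P (NW₀ τ')) 0 (SU N)) hw (flipClosed_layer₂ T₀ hmd slot₀ hinj fpol θ₀ fun K τ' i => vX K τ' i)
    (fun _ _ _ _ _ _ => Filter.EventuallyEq.rfl) hfix

/-! ## §5 The FIXED block of the older histories as a represented family of its own; the fixed-block binder REDUCED to the older
level (the patterns summed out: `Σ_S layerSibWf (τ', S) = fixSibW τ'`) -/

/-- the number of fixed factors of an older history. [folklore] -/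
abbrev fixM (md m₀ : ℕ → ι₀ → ℕ) : ℕ → ι₀ → ℕ := fun K τ' => m₀ K τ' - md K τ'

/-- the slots of the fixed block, reindexed from `0`. [folklore] -/
abbrev fixSlot (md : ℕ → ι₀ → ℕ) (slot₀ : ℕ → ι₀ → ℕ → Σ _ : ℕ, ℕ) : ℕ → ι₀ → ℕ → Σ _ : ℕ, ℕ :=
  fun K τ' k => slot₀ K τ' (md K τ' + k)

/-- the polarities of the fixed block, reindexed from `0`. [folklore] -/
abbrev fixPol (md : ℕ → ι₀ → ℕ) (fpol : ℕ → ι₀ → ℕ → Pol) : ℕ → ι₀ → ℕ → Pol := fun K τ' k => fpol K τ' (md K τ' + k)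

/-- the thresholds of the fixed block, reindexed from `0`. [folklore] -/
abbrev fixThr (md : ℕ → ι₀ → ℕ) (θ₀ : ℕ → ι₀ → ℕ → ℝ) : ℕ → ι₀ → ℕ → ℝ := fun K τ' k => θ₀ K τ' (md K τ' + k)

/-- the window functionals of the fixed block, reindexed from `0`. [folklore] -/
abbrev fixVar {Ωw : ι₀ → Type*} (md : ℕ → ι₀ → ℕ) (v : (K : ℕ) → (τ' : ι₀) → ℕ → Ωw τ' → ℝ) :
    (K : ℕ) → (τ' : ι₀) → ℕ → Ωw τ' → ℝ := fun K τ' k => v K τ' (md K τ' + k)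

/-- **THE FIXED BLOCK'S SIBLING WEIGHT OF AN OLDER HISTORY ON THE WINDOW**: `T4LipschitzLedger.sibW` of the fixed block alone
(reindexed), against the window reference measure, with remainder the old density of the older history's weight — the standard
socket shape of the sibling-insertion machinery (`T4SiblingInsertion`), at the OLDER level, pattern-free. [folklore] -/
@[reducible] noncomputable def fixSibW (χ : ℕ → ℝ → ℝ) (κ : ℕ → ℝ) (NW₀ : ι₀ → ℕ) (md m₀ : ℕ → ι₀ → ℕ)
    (slot₀ : ℕ → ι₀ → ℕ → Σ _ : ℕ, ℕ) (fpol : ℕ → ι₀ → ℕ → Pol) (θ₀ : ℕ → ι₀ → ℕ → ℝ)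
    (v : (K : ℕ) → (τ' : ι₀) → ℕ → GaugeField (F.P (NW₀ τ')) 0 (SU N) → ℝ) (KX : ℕ → ℕ)
    (R : (K : ℕ) → ℝ → ι₀ → GaugeField (F.P (KX K)) 0 (SU N) → ℝ) (ρ : ℕ → ℝ) : (Σ _ : ℕ, ℕ) → ℕ → ℝ → ι₀ → ℝ :=
  sibW χ κ (fun _ τ' => fieldMeasure (F.P (NW₀ τ')) 0 (SU N)) (fixM md m₀) (fixSlot md slot₀) (fixPol md fpol) (fixThr md θ₀)
    (fixVar md v) (fun K t τ' V => (oldDensity F EML (KX K) (NW₀ τ') (R K t τ') V : ℝ)) ρ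

/-- **THE FIXED BLOCK IS A REPRESENTED FAMILY OF THE OLDER HISTORIES ON RUN `K_X`'S FINEST LEVEL**: the fixed-block weights `fixW` are
represented by the fixed factors alone (reindexed by `md + ·`: `Finset.prod_Ico_eq_prod_range`) times the older history's weight.
[folklore] -/
theorem termRepr_fixed (KX : ℕ → ℕ) (hχ : ∀ a, LipProfile (χ a) (κ a) (Lχ a))
    (hθ : ∀ K, ∀ τ' ∈ T₀ K, ∀ i < m₀ K τ', 0 < θ₀ K τ' i)
    (hwin : ∀ K, ∀ τ' ∈ T₀ K, ∀ i < m₀ K τ', slot₀ K τ' i ∈ (range (N₀ + 1)).sigma fun a => range (n a))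
    (hband : ∀ K, ∀ τ' ∈ T₀ K, ∀ i < m₀ K τ', (slot₀ K τ' i).1 ≤ K)
    (hv : ∀ K, ∀ τ' ∈ T₀ K, ∀ i < m₀ K τ', Measurable (vX K τ' i) ∧ Measurable (vY K τ' i))
    {RX : (K : ℕ) → ℝ → ι₀ → GaugeField (F.P (KX K)) 0 (SU N) → ℝ}
    (hR0 : ∀ K t, |t| ≤ l₀ → ∀ τ' ∈ T₀ K, 0 ≤ᵐ[fieldMeasure (F.P (KX K)) 0 (SU N)] RX K t τ')
    (hRi : ∀ K t, |t| ≤ l₀ → ∀ τ' ∈ T₀ K, Integrable (RX K t τ') (fieldMeasure (F.P (KX K)) 0 (SU N))) :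
    TermRepr l₀ T₀ (fixW F χ NW₀ md m₀ slot₀ fpol θ₀ vX KX RX) χ κ Lχ N₀ n (fun K _ => fieldMeasure (F.P (KX K)) 0 (SU N))
      (fixM md m₀) (fixSlot md slot₀) (fixPol md fpol) (fixThr md θ₀)
      (fun K τ' k U => fixVar md vX K τ' k (oldTr F EML (KX K) (NW₀ τ') U))
      (fun K τ' k U => fixVar md vY K τ' k (oldTr F EML (KX K) (NW₀ τ') U)) RX where
  profile := hχ
  thr_pos K τ' hτ' k hk := hθ K τ' hτ' _ (by have hk' : k < m₀ K τ' - md K τ' := hk; omega)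
  slot_mem K τ' hτ' k hk := hwin K τ' hτ' _ (by have hk' : k < m₀ K τ' - md K τ' := hk; omega)
  slot_band K τ' hτ' k hk := hband K τ' hτ' _ (by have hk' : k < m₀ K τ' - md K τ' := hk; omega)
  meas K τ' hτ' k hk :=
    have hk' : md K τ' + k < m₀ K τ' := by have hk' : k < m₀ K τ' - md K τ' := hk; omega
    ⟨(hv K τ' hτ' _ hk').1.comp (measurable_oldTr_SUN F (KX K) (NW₀ τ')),
      (hv K τ' hτ' _ hk').2.comp (measurable_oldTr_SUN F (KX K) (NW₀ τ'))⟩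
  rem_nonneg := hR0
  rem_int := hRi
  repr K t ht τ' hτ' := by
    unfold fixW
    refine integral_congr_ae (ae_of_all _ fun U => ?_)
    dsimp only
    rw [prod_Ico_eq_prod_range]
    rfl

/-- **… HENCE ON THE WINDOW** (the socket `termRepr_window_of_finest`), when the window is not deeper than the run: the fixed block
alone, read on the window of depth `NW₀ τ'`, with remainder the old density of the older history's weight — the family whose `sibW` is
`fixSibW`.  This is where a small-field-floor bound on the fixed block's sibling weights is to be supplied (binders `hfixA`/`hfixB` of
§6). [folklore] -/
theorem termRepr_fixed_window (KX : ℕ → ℕ) (hNW : ∀ K, ∀ τ' ∈ T₀ K, NW₀ τ' ≤ KX K) (hχ : ∀ a, LipProfile (χ a) (κ a) (Lχ a))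
    (hθ : ∀ K, ∀ τ' ∈ T₀ K, ∀ i < m₀ K τ', 0 < θ₀ K τ' i)
    (hwin : ∀ K, ∀ τ' ∈ T₀ K, ∀ i < m₀ K τ', slot₀ K τ' i ∈ (range (N₀ + 1)).sigma fun a => range (n a))
    (hband : ∀ K, ∀ τ' ∈ T₀ K, ∀ i < m₀ K τ', (slot₀ K τ' i).1 ≤ K)
    (hv : ∀ K, ∀ τ' ∈ T₀ K, ∀ i < m₀ K τ', Measurable (vX K τ' i) ∧ Measurable (vY K τ' i))
    {RX : (K : ℕ) → ℝ → ι₀ → GaugeField (F.P (KX K)) 0 (SU N) → ℝ}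
    (hR0 : ∀ K t, |t| ≤ l₀ → ∀ τ' ∈ T₀ K, 0 ≤ᵐ[fieldMeasure (F.P (KX K)) 0 (SU N)] RX K t τ')
    (hRi : ∀ K t, |t| ≤ l₀ → ∀ τ' ∈ T₀ K, Integrable (RX K t τ') (fieldMeasure (F.P (KX K)) 0 (SU N))) :
    TermRepr l₀ T₀ (fixW F χ NW₀ md m₀ slot₀ fpol θ₀ vX KX RX) χ κ Lχ N₀ n (fun _ τ' => fieldMeasure (F.P (NW₀ τ')) 0 (SU N))
      (fixM md m₀) (fixSlot md slot₀) (fixPol md fpol) (fixThr md θ₀) (fixVar md vX) (fixVar md vY)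
      (fun K t τ' V => (oldDensity F EML (KX K) (NW₀ τ') (RX K t τ') V : ℝ)) :=
  termRepr_window_of_finest F NW₀ KX hNW
    (fun K τ' hτ' k hk => hv K τ' hτ' _ (by have hk' : k < m₀ K τ' - md K τ' := hk; omega))
    (termRepr_fixed F KX hχ hθ hwin hband hv hR0 hRi)

/-- **THE PATTERNS SUM OUT OF THE FIXED BLOCK'S SIBLING WEIGHTS**: over one older history `τ' ∈ T₀ K`, the `2^{md}` layered terms' fixed
sibling weights of slot `σ` (`layerSibWf`, on the window) total the older history's own `fixSibW` (`sum_powerset_sibAt_mixed` under the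
integral sign; the summands are integrable by the layer's window representation). [folklore] -/
theorem sum_patterns_layerSibWf (KX : ℕ → ℕ) {X : ℕ → ℝ → ι₀ × Finset ℕ → ℝ}
    {RX : (K : ℕ) → ℝ → ι₀ → GaugeField (F.P (KX K)) 0 (SU N) → ℝ} {ρ : ℕ → ℝ}
    (hw : TermRepr l₀ (layerT₂ T₀ md) X χ κ Lχ N₀ n (fun _ τ => fieldMeasure (F.P (NW₀ τ.1)) 0 (SU N)) (layerM₂ m₀)
      (layerSlot₂ slot₀) (layerPol₂ md fpol) (layerThr θ₀) (layerVar₂ vX) (layerVar₂ vY)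
      (fun K t τ V => (oldDensity F EML (KX K) (NW₀ τ.1) (layerRem RX K t τ) V : ℝ)))
    (σ : Σ _ : ℕ, ℕ) (K : ℕ) {t : ℝ} (ht : |t| ≤ l₀) {τ' : ι₀} (hτ' : τ' ∈ T₀ K) :
    ∑ S ∈ (range (md K τ')).powerset, layerSibWf F χ κ NW₀ md m₀ slot₀ fpol θ₀ vX KX RX ρ σ K t (τ', S) =
      fixSibW F χ κ NW₀ md m₀ slot₀ fpol θ₀ vX KX RX ρ σ K t τ' := by
  have hmem : ∀ S ∈ (range (md K τ')).powerset, (τ', S) ∈ layerT₂ T₀ md K := fun S hS =>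
    mem_layerT₂.2 ⟨hτ', mem_powerset.1 hS⟩
  unfold layerSibWf fixSibW sibWf sibW
  dsimp only [layerM₂, layerSlot₂, layerPol₂, layerThr, layerVar₂, fixM, fixSlot, fixPol, fixThr, fixVar]
  simp_rw [Finset.sum_filter]
  rw [Finset.sum_comm, Finset.sum_Ico_eq_sum_range]
  refine sum_congr rfl fun k hk => ?_
  have hkm : md K τ' + k < m₀ K τ' := by have := mem_range.1 hk; omega
  by_cases hkσ : slot₀ K τ' (md K τ' + k) = σ
  · simp_rw [if_pos hkσ]
    have hI : ∀ S ∈ (range (md K τ')).powerset, Integrable (fun V => sibAt χ κ (slot₀ K τ')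
        (fun i => if i < md K τ' then patPol S i else fpol K τ' i) (θ₀ K τ') (fun j => vX K τ' j V)
        (ρ (K - (slot₀ K τ' (md K τ' + k)).1)) (m₀ K τ') (md K τ' + k) * (oldDensity F EML (KX K) (NW₀ τ') (RX K t τ') V : ℝ))
        (fieldMeasure (F.P (NW₀ τ')) 0 (SU N)) := fun S hS => hw.integrable_sib ht (hmem S hS) hkm _
    refine (integral_finsetSum _ hI).symm.trans (integral_congr_ae (ae_of_all _ fun V => ?_))
    dsimp only
    rw [← sum_mul, sum_powerset_sibAt_mixed]
  · simp_rw [if_neg hkσ, Finset.sum_const_zero]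

/-- **THE FIXED-BLOCK BINDER, REDUCED TO THE OLDER LEVEL**: a sibling suppression `S_f` of the older histories' fixed blocks
(`fixSibW` against `fixW`, the socket of `termRepr_fixed_window`) IS the layered family's fixed-part suppression `S_f` (`layerSibWf` against
`layerX₂`) — both sides are the same numbers once the patterns are summed (`sum_patterns_layerSibWf`, `sum_layerOver_layerX₂`).
[folklore] -/
theorem siblingSuppression_layerSibWf_of_fixed (KX : ℕ → ℕ) {RX : (K : ℕ) → ℝ → ι₀ → GaugeField (F.P (KX K)) 0 (SU N) → ℝ}
    {ρ Sf : ℕ → ℝ} (hχ : ∀ a, LipProfile (χ a) (κ a) (Lχ a)) (hmd : ∀ K, ∀ τ' ∈ T₀ K, md K τ' ≤ m₀ K τ')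
    (hv : ∀ K, ∀ τ' ∈ T₀ K, ∀ i < m₀ K τ', Measurable (vX K τ' i) ∧ Measurable (vY K τ' i))
    (hRi : ∀ K t, |t| ≤ l₀ → ∀ τ' ∈ T₀ K, Integrable (RX K t τ') (fieldMeasure (F.P (KX K)) 0 (SU N)))
    (hw : TermRepr l₀ (layerT₂ T₀ md) (layerX₂ F χ NW₀ md m₀ slot₀ fpol θ₀ vX KX RX) χ κ Lχ N₀ n
      (fun _ τ => fieldMeasure (F.P (NW₀ τ.1)) 0 (SU N)) (layerM₂ m₀) (layerSlot₂ slot₀) (layerPol₂ md fpol) (layerThr θ₀)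
      (layerVar₂ vX) (layerVar₂ vY) (fun K t τ V => (oldDensity F EML (KX K) (NW₀ τ.1) (layerRem RX K t τ) V : ℝ)))
    (hfix₀ : SiblingSuppression l₀ T₀ (fixW F χ NW₀ md m₀ slot₀ fpol θ₀ vX KX RX) N₀ n
      (fixSibW F χ κ NW₀ md m₀ slot₀ fpol θ₀ vX KX RX ρ) Sf) :
    SiblingSuppression l₀ (layerT₂ T₀ md) (layerX₂ F χ NW₀ md m₀ slot₀ fpol θ₀ vX KX RX) N₀ n
      (layerSibWf F χ κ NW₀ md m₀ slot₀ fpol θ₀ vX KX RX ρ) Sf := by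
  intro σ hσ K t ht
  have hX : ∑ τ ∈ layerT₂ T₀ md K, layerX₂ F χ NW₀ md m₀ slot₀ fpol θ₀ vX KX RX K t τ =
      ∑ τ' ∈ T₀ K, fixW F χ NW₀ md m₀ slot₀ fpol θ₀ vX KX RX K t τ' :=
    sum_layerOver_layerX₂ F KX hχ hmd hv hRi K ht subset_rfl
  have hS : ∑ τ ∈ layerT₂ T₀ md K, layerSibWf F χ κ NW₀ md m₀ slot₀ fpol θ₀ vX KX RX ρ σ K t τ =
      ∑ τ' ∈ T₀ K, fixSibW F χ κ NW₀ md m₀ slot₀ fpol θ₀ vX KX RX ρ σ K t τ' := by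
    rw [layerT₂, sum_layerOver]
    exact sum_congr rfl fun τ' hτ' => sum_patterns_layerSibWf F KX hw σ K ht hτ'
  rw [hX, hS]
  exact hfix₀ σ hσ K t ht

end Layer

/-! ## §6 The η-design end-to-end with the pattern layer discharged -/

section EndToEnd

variable {ι₀ : Type*} [DecidableEq ι₀] {N : ℕ} [NeZero N] (F : T4Family)

/-- Bałaban's exp-mean-log small-plaquette average (0.4) on `SU(N)` (`ExpMeanLog.expMeanLogSU`). -/
local notation "EML" => (expMeanLogSU : LoopAverage (SU N))

/-- **`cauchy_of_finest` WITH THE PATTERN LAYER DISCHARGED.**  Data: an older-history family `T₀` with `K`-free window depths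
`NW₀ τ' ≤ K`, finest-level weights `R_A K t τ'` (run A, cutoff `K`) and `R_B K t τ'` (run B, cutoff `K + 1`), a.e. nonnegative and
integrable; Lipschitz cut-off profiles `χ a` by age; per older history `m₀ K τ'` declared factors, the first `md K τ' ≤ m₀ K τ'`
patterned, with slots in the window of ages `≤ N₀` (copies `< n a`, age `≤ K`) injective on the patterned block, positive thresholds,
fixed polarities `fpol` behind the patterned block, and measurable window functionals `vA`, `vB` on the window of depth `NW₀ τ'`.
DISCHARGED (this module): both runs' term representations, the patterned part `2` of the sibling suppression in both runs, the
window-depth and measurability side conditions, the transfer of the partition-function identities, of positivity and of the bad-class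
bound through neutrality.  REMAINING BINDERS, all NOT PRINTED as such (nothing of Bałaban's asserted): the older family's
`RelWeightBound` on fixed-block weights (cell estimate NE7b), the two-run closeness `hvc` of the window functionals at rate
`ρ (K − a)` (node U1a), the FIXED block's sibling suppression `S_f ≥ 0` in both runs, stated at the OLDER level on the fixed block
alone (`hfixA`, `hfixB`: `SiblingSuppression l₀ T₀ fixW … fixSibW S_f`, the family of `termRepr_fixed_window` — the small-field floor's
socket), node U5b's two-sided factor ledger `hsw` between the PATTERN-FREE old densities of the good older histories, positivity,
summable `δ` and `ρ`, and `W K + Σ_{a ≤ N₀} n a · lipWeight Lχ (2 + S_f) ρ a K < 1`.  Output: `cauchy_of_finest`'s conclusion with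
that budget. [folklore] -/
theorem cauchy_of_finest_layer₂ {l₀ vol : ℝ} {T₀ : ℕ → Finset ι₀} {Bad₀ : ℕ → ℝ → Finset ι₀} {W δ ρ Sf : ℕ → ℝ}
    {χ : ℕ → ℝ → ℝ} {κ Lχ : ℕ → ℝ} (hχ : ∀ a, LipProfile (χ a) (κ a) (Lχ a)) {N₀ : ℕ} {n : ℕ → ℕ}
    {NW₀ : ι₀ → ℕ} (hNW : ∀ K, ∀ τ' ∈ T₀ K, NW₀ τ' ≤ K)
    {md m₀ : ℕ → ι₀ → ℕ} (hmd : ∀ K, ∀ τ' ∈ T₀ K, md K τ' ≤ m₀ K τ')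
    {slot₀ : ℕ → ι₀ → ℕ → Σ _ : ℕ, ℕ}
    (hwin : ∀ K, ∀ τ' ∈ T₀ K, ∀ i < m₀ K τ', slot₀ K τ' i ∈ (range (N₀ + 1)).sigma fun a => range (n a))
    (hband : ∀ K, ∀ τ' ∈ T₀ K, ∀ i < m₀ K τ', (slot₀ K τ' i).1 ≤ K)
    (hinj : ∀ K, ∀ τ' ∈ T₀ K, ∀ j < md K τ', ∀ j' < md K τ', slot₀ K τ' j = slot₀ K τ' j' → j = j')
    {fpol : ℕ → ι₀ → ℕ → Pol} {θ₀ : ℕ → ι₀ → ℕ → ℝ} (hθ : ∀ K, ∀ τ' ∈ T₀ K, ∀ i < m₀ K τ', 0 < θ₀ K τ' i)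
    {vA vB : (K : ℕ) → (τ' : ι₀) → ℕ → GaugeField (F.P (NW₀ τ')) 0 (SU N) → ℝ}
    (hvm : ∀ K, ∀ τ' ∈ T₀ K, ∀ i < m₀ K τ', Measurable (vA K τ' i) ∧ Measurable (vB K τ' i))
    (hvc : ∀ K, ∀ τ' ∈ T₀ K, ∀ i < m₀ K τ', ∀ᵐ V ∂fieldMeasure (F.P (NW₀ τ')) 0 (SU N),
      |vA K τ' i V - vB K τ' i V| ≤ ρ (K - (slot₀ K τ' i).1) * θ₀ K τ' i)
    {RA : (K : ℕ) → ℝ → ι₀ → GaugeField (F.P K) 0 (SU N) → ℝ}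
    {RB : (K : ℕ) → ℝ → ι₀ → GaugeField (F.P (K + 1)) 0 (SU N) → ℝ}
    (hRA0 : ∀ K t, |t| ≤ l₀ → ∀ τ' ∈ T₀ K, 0 ≤ᵐ[fieldMeasure (F.P K) 0 (SU N)] RA K t τ')
    (hRAi : ∀ K t, |t| ≤ l₀ → ∀ τ' ∈ T₀ K, Integrable (RA K t τ') (fieldMeasure (F.P K) 0 (SU N)))
    (hRB0 : ∀ K t, |t| ≤ l₀ → ∀ τ' ∈ T₀ K, 0 ≤ᵐ[fieldMeasure (F.P (K + 1)) 0 (SU N)] RB K t τ')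
    (hRBi : ∀ K t, |t| ≤ l₀ → ∀ τ' ∈ T₀ K, Integrable (RB K t τ') (fieldMeasure (F.P (K + 1)) 0 (SU N)))
    (hW : RelWeightBound l₀ T₀ (fixW F χ NW₀ md m₀ slot₀ fpol θ₀ vA (fun K => K) RA)
      (fixW F χ NW₀ md m₀ slot₀ fpol θ₀ vB (fun K => K + 1) RB) Bad₀ W)
    (hfixA : SiblingSuppression l₀ T₀ (fixW F χ NW₀ md m₀ slot₀ fpol θ₀ vA (fun K => K) RA) N₀ n
      (fixSibW F χ κ NW₀ md m₀ slot₀ fpol θ₀ vA (fun K => K) RA ρ) Sf)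
    (hfixB : SiblingSuppression l₀ T₀ (fixW F χ NW₀ md m₀ slot₀ fpol θ₀ vB (fun K => K + 1) RB) N₀ n
      (fixSibW F χ κ NW₀ md m₀ slot₀ fpol θ₀ vB (fun K => K + 1) RB ρ) Sf)
    (hSf : ∀ a ≤ N₀, 0 ≤ Sf a) (hvol : 0 < vol) (hl₀ : 0 ≤ l₀) (hρ0 : ∀ j, 0 ≤ ρ j) (hρ : Summable ρ)
    (hlt : ∀ K, W K + ∑ a ∈ range (N₀ + 1), (n a : ℝ) * lipWeight Lχ (fun a => 2 + Sf a) ρ a K < 1) {Z : ℕ → ℝ → ℝ}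
    (hZA : ∀ K t, |t| ≤ l₀ → Z K t = ∑ τ' ∈ T₀ K, fixW F χ NW₀ md m₀ slot₀ fpol θ₀ vA (fun K => K) RA K t τ')
    (hZB : ∀ K t, |t| ≤ l₀ → Z (K + 1) t = ∑ τ' ∈ T₀ K, fixW F χ NW₀ md m₀ slot₀ fpol θ₀ vB (fun K => K + 1) RB K t τ')
    (hpos : ∀ K t, |t| ≤ l₀ → 0 < ∑ τ' ∈ T₀ K, fixW F χ NW₀ md m₀ slot₀ fpol θ₀ vA (fun K => K) RA K t τ')
    (hδ : Summable δ) {c : ℕ → ℝ}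
    (hsw : ∀ K t, |t| ≤ l₀ → ∀ τ' ∈ T₀ K \ Bad₀ K t,
      (∀ᵐ V ∂fieldMeasure (F.P (NW₀ τ')) 0 (SU N),
          Real.exp (c K - vol * δ K) * (oldDensity F EML K (NW₀ τ') (RA K t τ') V : ℝ) ≤
            (oldDensity F EML (K + 1) (NW₀ τ') (RB K t τ') V : ℝ)) ∧
        (∀ᵐ V ∂fieldMeasure (F.P (NW₀ τ')) 0 (SU N),
          (oldDensity F EML (K + 1) (NW₀ τ') (RB K t τ') V : ℝ) ≤
            Real.exp (c K + vol * δ K) * (oldDensity F EML K (NW₀ τ') (RA K t τ') V : ℝ))) :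
    MatchingModConstants vol l₀
        (hybridDelta vol δ fun K => W K + ∑ a ∈ range (N₀ + 1), (n a : ℝ) * lipWeight Lχ (fun a => 2 + Sf a) ρ a K) Z ∧
      Summable (hybridDelta vol δ fun K => W K + ∑ a ∈ range (N₀ + 1), (n a : ℝ) * lipWeight Lχ (fun a => 2 + Sf a) ρ a K) ∧
      (∀ t : ℝ, |t| ≤ l₀ → CauchySeq fun K => genFun Z K t) ∧
      TendstoUniformlyOn (fun K t => genFun Z K t) (genFunLim Z) Filter.atTop {t | |t| ≤ l₀} := by
  -- both runs' finest-level representations (the binders `hA`, `hB`)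
  have hA := termRepr_layer₂_A F (md := md) (fpol := fpol) hχ hθ hwin hband hvm hRA0 hRAi
  have hB := termRepr_layer₂_B F (md := md) (fpol := fpol) hχ hθ hwin hband (fun K τ hτ i hi => (hvm K τ hτ i hi).symm)
    hRB0 hRBi
  -- the socket: both runs on the window of depth `NW₀ τ.1`
  have hT : ∀ K, ∀ τ ∈ layerT₂ T₀ md K, (fun τ : ι₀ × Finset ℕ => NW₀ τ.1) τ ≤ K := fun K τ hτ =>
    hNW K τ.1 (mem_layerT₂.1 hτ).1
  have hmeas : ∀ K, ∀ τ ∈ layerT₂ T₀ md K, ∀ i < layerM₂ m₀ K τ,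
      Measurable (layerVar₂ vA K τ i) ∧ Measurable (layerVar₂ vB K τ i) := fun K τ hτ i hi =>
    hvm K τ.1 (mem_layerT₂.1 hτ).1 i hi
  have hwA : TermRepr l₀ (layerT₂ T₀ md) (layerX₂ F χ NW₀ md m₀ slot₀ fpol θ₀ vA (fun K => K) RA) χ κ Lχ N₀ n
      (fun _ τ => fieldMeasure (F.P (NW₀ τ.1)) 0 (SU N)) (layerM₂ m₀) (layerSlot₂ slot₀) (layerPol₂ md fpol) (layerThr θ₀)
      (layerVar₂ vA) (layerVar₂ vB) (fun K t τ V => (oldDensity F EML ((fun K => K) K) (NW₀ τ.1) (layerRem RA K t τ) V : ℝ)) :=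
    termRepr_window_of_finest_A F (fun τ : ι₀ × Finset ℕ => NW₀ τ.1) hT hmeas hA
  have hwB : TermRepr l₀ (layerT₂ T₀ md) (layerX₂ F χ NW₀ md m₀ slot₀ fpol θ₀ vB (fun K => K + 1) RB) χ κ Lχ N₀ n
      (fun _ τ => fieldMeasure (F.P (NW₀ τ.1)) 0 (SU N)) (layerM₂ m₀) (layerSlot₂ slot₀) (layerPol₂ md fpol) (layerThr θ₀)
      (layerVar₂ vB) (layerVar₂ vA)
      (fun K t τ V => (oldDensity F EML ((fun K => K + 1) K) (NW₀ τ.1) (layerRem RB K t τ) V : ℝ)) :=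
    termRepr_window_of_finest_B F (fun τ : ι₀ × Finset ℕ => NW₀ τ.1) (fun K τ hτ => Nat.le_succ_of_le (hT K τ hτ))
      (fun K τ hτ i hi => (hmeas K τ hτ i hi).symm) hB
  -- sibling suppression `2 + S_f` in both runs (the binders `hSA`, `hSB`)
  have hSA := siblingSuppression_layer₂ F (fun K => K) (ρ := ρ) hmd hinj hwA
    (siblingSuppression_layerSibWf_of_fixed F (fun K => K) hχ hmd hvm hRAi hwA hfixA)
  have hSB := siblingSuppression_layer₂ F (fun K => K + 1) (ρ := ρ) hmd hinj hwB
    (siblingSuppression_layerSibWf_of_fixed F (fun K => K + 1) hχ hmd (fun K τ hτ i hi => (hvm K τ hτ i hi).symm) hRBi hwB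
      hfixB)
  -- neutrality: the partition functions and positivity transfer
  have hsumA : ∀ K t, |t| ≤ l₀ → ∀ B' ⊆ T₀ K, ∑ τ ∈ layerOver B' (md K),
      layerX₂ F χ NW₀ md m₀ slot₀ fpol θ₀ vA (fun K => K) RA K t τ =
        ∑ τ' ∈ B', fixW F χ NW₀ md m₀ slot₀ fpol θ₀ vA (fun K => K) RA K t τ' :=
    fun K t ht B' hB' => sum_layerOver_layerX₂ F (fun K => K) hχ hmd hvm hRAi K ht hB'
  have hsumB : ∀ K t, |t| ≤ l₀ → ∀ B' ⊆ T₀ K, ∑ τ ∈ layerOver B' (md K),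
      layerX₂ F χ NW₀ md m₀ slot₀ fpol θ₀ vB (fun K => K + 1) RB K t τ =
        ∑ τ' ∈ B', fixW F χ NW₀ md m₀ slot₀ fpol θ₀ vB (fun K => K + 1) RB K t τ' :=
    fun K t ht B' hB' => sum_layerOver_layerX₂ F (fun K => K + 1) hχ hmd (fun K τ hτ i hi => (hvm K τ hτ i hi).symm) hRBi K ht hB'
  have hW' := relWeightBound_layer₂ (md := md) hW hsumA hsumB
  have hZA' : ∀ K t, |t| ≤ l₀ → Z K t = ∑ τ ∈ layerT₂ T₀ md K, layerX₂ F χ NW₀ md m₀ slot₀ fpol θ₀ vA (fun K => K) RA K t τ :=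
    fun K t ht => by rw [layerT₂, hsumA K t ht _ subset_rfl]; exact hZA K t ht
  have hZB' : ∀ K t, |t| ≤ l₀ →
      Z (K + 1) t = ∑ τ ∈ layerT₂ T₀ md K, layerX₂ F χ NW₀ md m₀ slot₀ fpol θ₀ vB (fun K => K + 1) RB K t τ :=
    fun K t ht => by rw [layerT₂, hsumB K t ht _ subset_rfl]; exact hZB K t ht
  have hpos' : ∀ K t, |t| ≤ l₀ → 0 < ∑ τ ∈ layerT₂ T₀ md K, layerX₂ F χ NW₀ md m₀ slot₀ fpol θ₀ vA (fun K => K) RA K t τ :=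
    fun K t ht => by rw [layerT₂, hsumA K t ht _ subset_rfl]; exact hpos K t ht
  -- the two-run closeness of the window functionals
  have hF : SupClose (layerT₂ T₀ md) (fun _ τ => fieldMeasure (F.P (NW₀ τ.1)) 0 (SU N)) (layerM₂ m₀) (layerSlot₂ slot₀)
      (layerThr θ₀) (layerVar₂ vA) (layerVar₂ vB) ρ := fun K τ hτ i hi => hvc K τ.1 (mem_layerT₂.1 hτ).1 i hi
  -- the suppression constants are nonnegative
  have hS : ∀ a ≤ N₀, 0 ≤ (fun a => 2 + Sf a) a := fun a ha => by
    show (0 : ℝ) ≤ 2 + Sf a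
    linarith [hSf a ha]
  -- node U5b's ledger on the good layered terms: pattern-free
  have hsw' : ∀ K t, |t| ≤ l₀ → ∀ τ ∈ layerT₂ T₀ md K \ layerOver (Bad₀ K t) (md K),
      (∀ᵐ V ∂fieldMeasure (F.P (NW₀ τ.1)) 0 (SU N), Real.exp (c K - vol * δ K) *
          (oldDensity F EML K (NW₀ τ.1) (layerRem RA K t τ) V : ℝ) ≤ (oldDensity F EML (K + 1) (NW₀ τ.1) (layerRem RB K t τ) V : ℝ)) ∧
        (∀ᵐ V ∂fieldMeasure (F.P (NW₀ τ.1)) 0 (SU N), (oldDensity F EML (K + 1) (NW₀ τ.1) (layerRem RB K t τ) V : ℝ) ≤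
          Real.exp (c K + vol * δ K) * (oldDensity F EML K (NW₀ τ.1) (layerRem RA K t τ) V : ℝ)) := by
    intro K t ht τ hτ
    obtain ⟨h1, h2⟩ := mem_sdiff.1 hτ
    obtain ⟨h1a, h1b⟩ := mem_layerT₂.1 h1
    have h3 : τ.1 ∉ Bad₀ K t := fun hb => h2 (mem_layerOver.2 ⟨hb, h1b⟩)
    exact hsw K t ht τ.1 (mem_sdiff.2 ⟨h1a, h3⟩)
  exact cauchy_of_finest F (fun τ : ι₀ × Finset ℕ => NW₀ τ.1) (uA := layerVar₂ vA) (uB := layerVar₂ vB) (S := fun a => 2 + Sf a)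
    hvol hl₀ hW' hT hmeas hA hB hF hSA hSB hS hρ0 hρ hlt hZA' hZB' hpos' hδ hsw'

/-- **THE ALL-PATTERNED CASE** (`md = m₀`: every declared factor flip-closed, EMPTY fixed block): the fixed block's binders are
DISCHARGED (`siblingSuppression_sibW_of_eq_zero`), the budget is `W K + Σ_{a ≤ N₀} n a · lipWeight Lχ 2 ρ a K`.  At `NW₀ ≡ 0`,
`slot₀ K τ' i = ⟨0, i⟩`, one profile, this is `T4AgeZeroLayer.cauchy_of_finest_layer`. [folklore] -/
theorem cauchy_of_finest_patterned {l₀ vol : ℝ} {T₀ : ℕ → Finset ι₀} {Bad₀ : ℕ → ℝ → Finset ι₀} {W δ ρ : ℕ → ℝ}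
    {χ : ℕ → ℝ → ℝ} {κ Lχ : ℕ → ℝ} (hχ : ∀ a, LipProfile (χ a) (κ a) (Lχ a)) {N₀ : ℕ} {n : ℕ → ℕ}
    {NW₀ : ι₀ → ℕ} (hNW : ∀ K, ∀ τ' ∈ T₀ K, NW₀ τ' ≤ K) {m₀ : ℕ → ι₀ → ℕ} {slot₀ : ℕ → ι₀ → ℕ → Σ _ : ℕ, ℕ}
    (hwin : ∀ K, ∀ τ' ∈ T₀ K, ∀ i < m₀ K τ', slot₀ K τ' i ∈ (range (N₀ + 1)).sigma fun a => range (n a))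
    (hband : ∀ K, ∀ τ' ∈ T₀ K, ∀ i < m₀ K τ', (slot₀ K τ' i).1 ≤ K)
    (hinj : ∀ K, ∀ τ' ∈ T₀ K, ∀ j < m₀ K τ', ∀ j' < m₀ K τ', slot₀ K τ' j = slot₀ K τ' j' → j = j')
    {fpol : ℕ → ι₀ → ℕ → Pol} {θ₀ : ℕ → ι₀ → ℕ → ℝ} (hθ : ∀ K, ∀ τ' ∈ T₀ K, ∀ i < m₀ K τ', 0 < θ₀ K τ' i)
    {vA vB : (K : ℕ) → (τ' : ι₀) → ℕ → GaugeField (F.P (NW₀ τ')) 0 (SU N) → ℝ}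
    (hvm : ∀ K, ∀ τ' ∈ T₀ K, ∀ i < m₀ K τ', Measurable (vA K τ' i) ∧ Measurable (vB K τ' i))
    (hvc : ∀ K, ∀ τ' ∈ T₀ K, ∀ i < m₀ K τ', ∀ᵐ V ∂fieldMeasure (F.P (NW₀ τ')) 0 (SU N),
      |vA K τ' i V - vB K τ' i V| ≤ ρ (K - (slot₀ K τ' i).1) * θ₀ K τ' i)
    {RA : (K : ℕ) → ℝ → ι₀ → GaugeField (F.P K) 0 (SU N) → ℝ}
    {RB : (K : ℕ) → ℝ → ι₀ → GaugeField (F.P (K + 1)) 0 (SU N) → ℝ}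
    (hRA0 : ∀ K t, |t| ≤ l₀ → ∀ τ' ∈ T₀ K, 0 ≤ᵐ[fieldMeasure (F.P K) 0 (SU N)] RA K t τ')
    (hRAi : ∀ K t, |t| ≤ l₀ → ∀ τ' ∈ T₀ K, Integrable (RA K t τ') (fieldMeasure (F.P K) 0 (SU N)))
    (hRB0 : ∀ K t, |t| ≤ l₀ → ∀ τ' ∈ T₀ K, 0 ≤ᵐ[fieldMeasure (F.P (K + 1)) 0 (SU N)] RB K t τ')
    (hRBi : ∀ K t, |t| ≤ l₀ → ∀ τ' ∈ T₀ K, Integrable (RB K t τ') (fieldMeasure (F.P (K + 1)) 0 (SU N)))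
    (hW : RelWeightBound l₀ T₀ (fixW F χ NW₀ m₀ m₀ slot₀ fpol θ₀ vA (fun K => K) RA)
      (fixW F χ NW₀ m₀ m₀ slot₀ fpol θ₀ vB (fun K => K + 1) RB) Bad₀ W)
    (hvol : 0 < vol) (hl₀ : 0 ≤ l₀) (hρ0 : ∀ j, 0 ≤ ρ j) (hρ : Summable ρ)
    (hlt : ∀ K, W K + ∑ a ∈ range (N₀ + 1), (n a : ℝ) * lipWeight Lχ (fun _ => 2) ρ a K < 1) {Z : ℕ → ℝ → ℝ}
    (hZA : ∀ K t, |t| ≤ l₀ → Z K t = ∑ τ' ∈ T₀ K, fixW F χ NW₀ m₀ m₀ slot₀ fpol θ₀ vA (fun K => K) RA K t τ')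
    (hZB : ∀ K t, |t| ≤ l₀ → Z (K + 1) t = ∑ τ' ∈ T₀ K, fixW F χ NW₀ m₀ m₀ slot₀ fpol θ₀ vB (fun K => K + 1) RB K t τ')
    (hpos : ∀ K t, |t| ≤ l₀ → 0 < ∑ τ' ∈ T₀ K, fixW F χ NW₀ m₀ m₀ slot₀ fpol θ₀ vA (fun K => K) RA K t τ')
    (hδ : Summable δ) {c : ℕ → ℝ}
    (hsw : ∀ K t, |t| ≤ l₀ → ∀ τ' ∈ T₀ K \ Bad₀ K t,
      (∀ᵐ V ∂fieldMeasure (F.P (NW₀ τ')) 0 (SU N),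
          Real.exp (c K - vol * δ K) * (oldDensity F EML K (NW₀ τ') (RA K t τ') V : ℝ) ≤
            (oldDensity F EML (K + 1) (NW₀ τ') (RB K t τ') V : ℝ)) ∧
        (∀ᵐ V ∂fieldMeasure (F.P (NW₀ τ')) 0 (SU N),
          (oldDensity F EML (K + 1) (NW₀ τ') (RB K t τ') V : ℝ) ≤
            Real.exp (c K + vol * δ K) * (oldDensity F EML K (NW₀ τ') (RA K t τ') V : ℝ))) :
    MatchingModConstants vol l₀
        (hybridDelta vol δ fun K => W K + ∑ a ∈ range (N₀ + 1), (n a : ℝ) * lipWeight Lχ (fun _ => 2) ρ a K) Z ∧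
      Summable (hybridDelta vol δ fun K => W K + ∑ a ∈ range (N₀ + 1), (n a : ℝ) * lipWeight Lχ (fun _ => 2) ρ a K) ∧
      (∀ t : ℝ, |t| ≤ l₀ → CauchySeq fun K => genFun Z K t) ∧
      TendstoUniformlyOn (fun K t => genFun Z K t) (genFunLim Z) Filter.atTop {t | |t| ≤ l₀} := by
  have h0 : ∀ K, ∀ τ' ∈ T₀ K, fixM m₀ m₀ K τ' = 0 := fun K τ' _ => Nat.sub_self _
  have hfixA : SiblingSuppression l₀ T₀ (fixW F χ NW₀ m₀ m₀ slot₀ fpol θ₀ vA (fun K => K) RA) N₀ n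
      (fixSibW F χ κ NW₀ m₀ m₀ slot₀ fpol θ₀ vA (fun K => K) RA ρ) (fun _ => 0) :=
    siblingSuppression_sibW_of_eq_zero h0
  have hfixB : SiblingSuppression l₀ T₀ (fixW F χ NW₀ m₀ m₀ slot₀ fpol θ₀ vB (fun K => K + 1) RB) N₀ n
      (fixSibW F χ κ NW₀ m₀ m₀ slot₀ fpol θ₀ vB (fun K => K + 1) RB ρ) (fun _ => 0) :=
    siblingSuppression_sibW_of_eq_zero h0
  have e : (fun a : ℕ => (2 : ℝ) + (fun _ : ℕ => (0 : ℝ)) a) = fun _ => 2 := by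
    funext a
    simp
  have hlt' : ∀ K, W K + ∑ a ∈ range (N₀ + 1), (n a : ℝ) * lipWeight Lχ (fun a => 2 + (fun _ : ℕ => (0 : ℝ)) a) ρ a K < 1 := by
    rw [e]
    exact hlt
  have main := cauchy_of_finest_layer₂ F (Sf := fun _ => 0) hχ hNW (fun _ _ _ => le_rfl) hwin hband hinj hθ hvm hvc
    hRA0 hRAi hRB0 hRBi hW hfixA hfixB (fun _ _ => le_rfl) hvol hl₀ hρ0 hρ hlt' hZA hZB hpos hδ hsw
  rw [e] at main
  exact main

end EndToEnd

/-! ## §7 Sanity (kernel-checked instances; nothing printed) -/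

namespace Sanity

/-- two patterned positions in front of one fixed LARGE factor: the four patterns total the fixed factor `1 − x₂`, numerically
(`x₀ = 1/4`, `x₁ = 2/3`, `x₂ = 1/5`). [folklore] -/
example : ∑ S ∈ (range 2).powerset, ∏ i ∈ range 3,
      (if i < 2 then patPol S i else Pol.large).fac ((fun i => if i = 0 then (1 / 4 : ℝ) else if i = 1 then 2 / 3 else 1 / 5) i) =
    ∏ i ∈ Ico 2 3, (Pol.large).fac ((fun i => if i = 0 then (1 / 4 : ℝ) else if i = 1 then 2 / 3 else 1 / 5) i) :=
  sum_powerset_prod_mixed (by norm_num) _ _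

/-- … and that fixed factor is `4/5`. [folklore] -/
example : ∏ i ∈ Ico 2 3, (Pol.large).fac ((fun i => if i = 0 then (1 / 4 : ℝ) else if i = 1 then 2 / 3 else 1 / 5) i) = 4 / 5 := by
  norm_num [Pol.fac]

/-- the flip relabelling at a slot holding patterned position `1` (of `2`; slots `⟨3, 0⟩`, `⟨1, 4⟩`, then a fixed `⟨1, 4⟩`) toggles
position `1` only — the fixed factor sharing the slot is not touched. [folklore] -/
example : layerPsi (ι₀ := Unit) (fun _ _ => 2)
      (fun _ _ i => if i = 0 then ⟨3, 0⟩ else ⟨1, 4⟩) 7 ⟨1, 4⟩ ((), {0, 1}) = {0} := by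
  decide

/-- … a slot holding no patterned position relabels nothing. [folklore] -/
example : layerPsi (ι₀ := Unit) (fun _ _ => 2)
      (fun _ _ i => if i = 0 then ⟨3, 0⟩ else ⟨1, 4⟩) 7 ⟨0, 0⟩ ((), {0, 1}) = {0, 1} := by
  decide

/-- the fixed block of an older history with `5` declared factors, `2` patterned: `3` factors, the `k`-th in the slot of declared
position `2 + k`. [folklore] -/
example : fixM (ι₀ := Unit) (fun _ _ => 2) (fun _ _ => 5) 0 () = 3 ∧
    fixSlot (ι₀ := Unit) (fun _ _ => 2) (fun _ _ i => (⟨i, 7⟩ : Σ _ : ℕ, ℕ)) 0 () 1 = ⟨3, 7⟩ := by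
  decide

/-- membership in the layered family: the pattern must live on the patterned block of ITS older history. [folklore] -/
example : ((5 : ℕ), ({0, 2} : Finset ℕ)) ∈ layerT₂ (fun _ => ({5, 6} : Finset ℕ)) (fun _ τ' => if τ' = 5 then 3 else 1) 0 ∧
    ((6 : ℕ), ({0, 2} : Finset ℕ)) ∉ layerT₂ (fun _ => ({5, 6} : Finset ℕ)) (fun _ τ' => if τ' = 5 then 3 else 1) 0 := by
  exact ⟨mem_layerT₂.2 ⟨by simp, by decide⟩, fun h => absurd (mem_layerT₂.1 h).2 (by decide)⟩

end Sanity

end Literature.MathematicalPhysics.QuantumFieldTheory.Balaban1983to89.T4PatternLayer
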